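import Literature.AlgebraicGeometry.ShimuraVarieties.UnitaryCurveAuxiliaryTorusLegArithmetic   -- ★ p850156: the framed scalar, `coe_auxToGspFinV_one_eq_frameScalar`, `𝓞̂_F` acts `ẑ`-integrally
import Literature.NumberTheory.NumberFields.IdeleActionOnIdealQuotients                         -- ★ `mem_iff_forall_valuation_le` (membership in a fractional ideal is local)
import Literature.NumberTheory.Adeles.FiniteAdeleLatticeOfGL                                  -- ★ `latticeOfGL`, `mem_latticeOfGL_iff`
import Literature.NumberTheory.GaloisRepresentations.HeckeCharacterOfRayClass                  -- ★ `modulusExp` (ED. 2: the junction՚s congruence `z ≡ 1 mod (N)`)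
import Literature.NumberTheory.AdelicBaseChange.IdeleConormIdeals                               -- ★ `unitOrd_finiteIdeleConorm` (ED. 3: `ord_v(con x) = e_v·ord_p x`)
import Literature.NumberTheory.NumberFields.IdealNormEquationSupportPin                        -- ★ `count_add_count_complexConj_smul_eq` (ED. 3: `(n) = 𝔞·c𝔞` prime by prime)
import HarnessLib

/-!
# The torus-leg lattice identity `Λ_{r′·ũ_β(1,z)} = 𝔞⁻¹·Λ_{r′}` for `[z] = 𝔞⁻¹` ([Shimura 1998] §18.3, §18.6; [Milne 2005] §6 Thm. 6.11 and p. 75)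

Topic `AlgebraicGeometry/ShimuraVarieties`; namespace `Literature.AlgebraicGeometry.ShimuraVarieties.UnitaryCurve.AuxV`.  THEOREMS ONLY (no definition,
no named fact, no instance, no notation, no `sorry`).  Cell `hodgecm-mathlib` (D-0151), FLOOR 0, P6 «MOD programme», crux item stmt-HodgeConjecture-24832
(hLiu418), X-LEAF sheet line, (S8) closer `stub_ESHEET`, road #29 B′ «Serre tensor per complex fibre», organ #32′ (K) «THE LATTICE IDENTITY `hr`» (LEAD
F0P6-plan (g4) «M-83» (2) ∕ «L4» LA4-plan (g2) STATUS #4 → LA5-p02 (g4)): the hypothesis `hr` of ★ `SiegelAdelicMarking.exists_marking_of_idealKernel`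
(p849685, (S2b): «the `𝔞`-quotient of an `[J, r′]`-marked variety is `[J, r]`-marked for any `r` cutting out `𝔞⁻¹Λ_{r′}`») at the TORUS LEG `r = r′·ũ_β(1, z)`
of the E1 carrier (★ `auxToGspFinV`) for the junction idèle `z` of ★ `IsSheetTwistOf` (`[z] = 𝔞⁻¹`, ★ `FiniteAdeleRing.toFractionalIdeal`).
`--supports stmt-HodgeConjecture-24832`, count-neutral; HC_CM is proved only modulo the printed citations until rung 0 closes; this file discharges none.

THE POINT ([Shimura1998] §18.3 p. 122 «`t𝔞`», §18.6 proof p. 127 «`A ⊗ 𝔞⁻¹ = ℂ^g ∕ 𝔞⁻¹Λ`»; [Milne2005ShimuraVarieties] §4 pp. 48–49 «`gΛ`», §6 Thm. 6.11 and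
p. 75).  In an `𝓞_F`-stable symplectic frame `Fr` (integral reading `ρ`, ★ p850156) the torus leg `ũ_β(1, z)` is the FRAMED SCALAR of `z` (★
`coe_auxToGspFinV_one_eq_frameScalar`); for `r′ = ũ_β(p)` (any adelic point `p` of `U × T`) and a central idèle `z` whose ideal is `𝔞⁻¹`,

  (K) `v ∈ Λ_{r′·ũ_β(1,z)} ↔ ∀ x ∈ 𝔞, ρ(x)·v ∈ Λ_{r′}`   («`Λ_{r′ z} = z·Λ_{r′} = 𝔞⁻¹Λ_{r′}`», `Λ_x = ℚ^{2g} ∩ x·ẑ^{2g}`).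

METHOD.  §1 (Dedekind arithmetic, no adèles) «TWO GENERATORS AND AN INVERSE PAIR»: for `𝔞 ≠ 0` there are `β₁, β₂ ∈ 𝔞` and `c₁, c₂ ∈ 𝔞⁻¹ ⊂ F` with
`c₁β₁ + c₂β₂ = 1` (`(β₁) = 𝔞𝔟`, `𝔞 = (β₁, β₂)` by Mathlib `IsDedekindDomain.exists_eq_span_pair`, `β₁ = β₁b₁ + β₂b₂` with `bₖ ∈ 𝔟`, `cₖ = bₖ∕β₁`).  §2 the
idèle `z` of `𝔞⁻¹`: `|z_v| = |𝔞|_v⁻¹`, `x z ∈ 𝓞̂_F` for `x ∈ 𝔞`, `z⁻¹ ∈ 𝓞̂_F`, and `z⁻¹ = s₁β₁ + s₂β₂` with `sₖ = cₖ z⁻¹ ∈ 𝓞̂_F` (★ `mem_iff_forall_valuation_le`: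
membership in `𝔞`, `𝔞⁻¹` is local).  §3 the framed scalar is multiplicative and commutes with `ũ_β(p)`; CORE on an arbitrary adelic vector `y`:
`P_𝔸res(z⁻¹)Q_𝔸·y ∈ ẑ ↔ ∀ x ∈ 𝔞, ρ(x)·y ∈ ẑ` (⇒: `x = (x z)·z⁻¹`, `𝓞̂_F` acts integrally ★ `frameScalar_integral_of_mem_integralFiniteAdeles`; ⇐: `z⁻¹ = Σ sₖβₖ`).
§4 HEAD (K) at `y = ũ_β(p)⁻¹v`.
§5 (ED. 2) THE JUNCTION FEEDERS of the (t3)(t5) readings through `r′·ũ_β(1,z)`: from `[z] = 𝔞⁻¹` and the congruence rows `|z_v| = 1`, `|z_v − 1| ≤ |N|_v` at `v ∣ N` of ★ `IsSheetTwistOf`: `z⁻¹ − 1 ∈ N·𝓞̂_F`, hence `ũ_β(1, z⁻¹) − 1 ∈ N·M_{2g}(ẑ)` (★ p850156 (hk); the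
`(r⁻¹r′) − 1` input of ★ `SiegelAdelicMarking.levelReading_comp_of_congr`, `r⁻¹r′ = ũ_β(1,z⁻¹)`), and `n·ũ_β(1,z) ∈ M_{2g}(ẑ)` for `n ∈ 𝔞` (★ p850156 (hT); the
(H1) input of ★ `SiegelAdelicMarking.pairingReading_comp_of_similitude`).
§6 (ED. 3) THE UNIT CLAUSE `ν·μ = ε ∈ ẑ^×` of ★ `pairingReading_comp_of_similitude` for the torus leg: with the torus condition `z·z̄ = q`
(`q` the multiplier of `ũ_β(a,z)`, ★ p850156 (hμ)), `[z] = 𝔞⁻¹` and row (a) `(n) = 𝔞·c𝔞`: `n·q ∈ ẑ^×` — at a place `v ∣ p` of `F`,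
`ord_v(n·z·z̄) = ord_v(n) − ord_v 𝔞 − ord_{cv} 𝔞 = 0` (★ `count_add_count_complexConj_smul_eq`) and `ord_v(con x) = e_v·ord_p x` (★ `unitOrd_finiteIdeleConorm`).
§7 (ED. 4) the `hint` feeder of ★ `exists_marking_of_idealKernel`: `𝓞_F` acts integrally on `Λ_{ũ_β(p)}` (`ρ(x)·Λ_{r′} ⊆ Λ_{r′}`).
§8 (ED. 5) CONSUMER ADAPTERS at `r := r′·ũ_β(1,z)` for ANY `r′ ∈ GSp_δ(𝔸_f)`: `r′⁻¹r = ũ_β(1,z)`, `r⁻¹r′ = ũ_β(1,z⁻¹)`, and the (H1)∕(hμ)∕(hk) binders of ★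
`pairingReading_comp_of_similitude` ∕ ★ `levelReading_comp_of_congr` in their own `r′⁻¹ * r` ∕ `r⁻¹ * r′` tokens.
§9 (ED. 6) (K) and `hint` at a representative MOVED by a rational `γ` (`r′ = γ·ũ_β(p)`, reading `γρ(x)γ⁻¹`; the chart՚s `γ = (q a)⁻¹`, `Mρ a = (q a)⁻¹ρ₀(q a)`).

## References
* [Shimura1998] G. Shimura, *Abelian Varieties with Complex Multiplication and Modular Functions* (1998), §18.3 pp. 122–123, §18.6 pp. 124–127.
* [Milne2005ShimuraVarieties] J. S. Milne, *Introduction to Shimura varieties* (2005), §4 pp. 48–49, §6 Thm. 6.11 p. 74 and p. 75, Def. 12.8 (60)–(62) p. 114.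
* [CasselsFrohlichANT1967] J. W. S. Cassels, A. Fröhlich (eds.), *Algebraic Number Theory* (1967), Ch. II §11, §14, §17.
* [NeukirchANT1999] J. Neukirch, *Algebraic Number Theory* (1999), Ch. I (3.1), Cor. (3.9).

#harness_tags number_theory.shimura_varieties, number_theory.adeles, linear_algebra.lattices
-/

set_option autoImplicit false

noncomputable section

open Matrix NumberField IsDedekindDomain
open scoped TensorProduct nonZeroDivisors
open Literature.AlgebraicGeometry.ModuliOfAbelianVarieties
open Literature.NumberTheory.Automorphic (integralFiniteAdeles mem_integralFiniteAdeles_iff)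
open Literature.NumberTheory.Adeles (latticeOfGL mem_latticeOfGL_iff)

namespace Literature.AlgebraicGeometry.ShimuraVarieties

namespace UnitaryCurve

namespace AuxV

open Literature.AlgebraicGeometry.ShimuraVarieties.UnitaryCanonicalModel.Aux (ratBasis torusFinAdelic torusToTensorFin)
open Literature.AlgebraicGeometry.ShimuraVarieties.UnitaryCurve.Aux (unitaryToTensorFin)
open Literature.NumberTheory.Automorphic Literature.NumberTheory.Automorphic.UnitaryGroup
open Literature.NumberTheory.ComplexMultiplication (ratFiniteAdeleTensorEquiv ratFiniteAdeleTensorEquiv_symm_algebraMap)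
open Literature.NumberTheory.Automorphic.FiniteAdeleRing (toFractionalIdeal count_toFractionalIdeal valued_apply_eq_exp_neg_unitOrd val_apply_mul_inv_apply)

variable {F : Type} [Field F] [NumberField F] [IsCMField F] {Jstar : Matrix (Fin 2) (Fin 2) F} {ξ : F} {g : ℕ} {δ : Fin g → ℕ}

/-! ### §1 Two generators and an inverse pair of an ideal of a Dedekind domain -/

omit [IsCMField F] in
/-- **TWO GENERATORS AND AN INVERSE PAIR.**  For a non-zero ideal `𝔞` of `𝓞_F` there are `β₁, β₂ ∈ 𝔞` and `c₁, c₂ ∈ F` with `c₁β₁ + c₂β₂ = 1` and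
`cₖ·𝔞 ⊆ 𝓞_F` (`cₖ ∈ 𝔞⁻¹`): `β₁ ∈ 𝔞` non-zero, `(β₁) = 𝔞𝔟`, `𝔞 = (β₁, β₂)` (Mathlib `IsDedekindDomain.exists_eq_span_pair`), `β₁ = β₁b₁ + β₂b₂` with
`bₖ ∈ 𝔟` (`(β₁) = (β₁)𝔟 + (β₂)𝔟`), `cₖ := bₖ∕β₁`, and `bₖ x ∈ 𝔞𝔟 = (β₁)` for `x ∈ 𝔞`.  «`𝔞 𝔞⁻¹ = 𝓞` with two generators».
[cite: NeukirchANT1999, Ch. I (3.1), Cor. (3.9)] [cite: CasselsFrohlichANT1967, Ch. II §17] -/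
theorem exists_pair_mem_and_inverse_pair (𝔞 : Ideal (𝓞 F)) (h𝔞 : 𝔞 ≠ ⊥) :
    ∃ β₁ β₂ : 𝓞 F, β₁ ∈ 𝔞 ∧ β₂ ∈ 𝔞 ∧ ∃ c₁ c₂ : F,
      c₁ * ((β₁ : 𝓞 F) : F) + c₂ * ((β₂ : 𝓞 F) : F) = 1 ∧
      (∀ x ∈ 𝔞, ∃ d : 𝓞 F, (d : F) = c₁ * ((x : 𝓞 F) : F)) ∧ (∀ x ∈ 𝔞, ∃ d : 𝓞 F, (d : F) = c₂ * ((x : 𝓞 F) : F)) := by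
  classical
  obtain ⟨β₁, hβ₁𝔞, hβ₁0⟩ := Submodule.exists_mem_ne_zero_of_ne_bot h𝔞
  have hβ₁F : ((β₁ : 𝓞 F) : F) ≠ 0 := fun h => hβ₁0 (by exact_mod_cast h)
  -- `(β₁) = 𝔞 𝔟`
  obtain ⟨𝔟, h𝔟⟩ : 𝔞 ∣ Ideal.span {β₁} := Ideal.dvd_iff_le.2 ((Ideal.span_singleton_le_iff_mem _).2 hβ₁𝔞)
  -- two generators `𝔞 = (β₁, β₂)`
  obtain ⟨β₂, h𝔞eq⟩ := IsDedekindDomain.exists_eq_span_pair hβ₁𝔞 hβ₁0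
  have hβ₂𝔞 : β₂ ∈ 𝔞 := by
    rw [h𝔞eq]; exact Ideal.subset_span (Set.mem_insert_of_mem _ (Set.mem_singleton _))
  -- `β₁ ∈ (β₁)𝔟 ⊔ (β₂)𝔟`
  have hmem : β₁ ∈ Ideal.span {β₁} * 𝔟 ⊔ Ideal.span {β₂} * 𝔟 := by
    have h : β₁ ∈ 𝔞 * 𝔟 := by rw [← h𝔟]; exact Ideal.mem_span_singleton_self β₁
    rwa [h𝔞eq, Ideal.span_insert, Ideal.sup_mul] at h
  obtain ⟨y₁, hy₁, y₂, hy₂, hsum⟩ := Submodule.mem_sup.1 hmem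
  obtain ⟨b₁, hb₁, rfl⟩ := Ideal.mem_span_singleton_mul.1 hy₁
  obtain ⟨b₂, hb₂, rfl⟩ := Ideal.mem_span_singleton_mul.1 hy₂
  have hsumF : ((β₁ : 𝓞 F) : F) * ((b₁ : 𝓞 F) : F) + ((β₂ : 𝓞 F) : F) * ((b₂ : 𝓞 F) : F) = ((β₁ : 𝓞 F) : F) := by
    exact_mod_cast hsum
  -- integrality: `x b ∈ 𝔞𝔟 = (β₁)`
  have hint : ∀ b ∈ 𝔟, ∀ x ∈ 𝔞, ∃ d : 𝓞 F, (d : F) = ((b : 𝓞 F) : F) / ((β₁ : 𝓞 F) : F) * ((x : 𝓞 F) : F) := by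
    intro b hb x hx
    have hxb : x * b ∈ Ideal.span {β₁} := by rw [h𝔟]; exact Ideal.mul_mem_mul hx hb
    obtain ⟨d, hd⟩ := Ideal.mem_span_singleton'.1 hxb
    refine ⟨d, ?_⟩
    have hdF : ((d : 𝓞 F) : F) * ((β₁ : 𝓞 F) : F) = ((x : 𝓞 F) : F) * ((b : 𝓞 F) : F) := by exact_mod_cast hd
    field_simp
    linear_combination hdF
  refine ⟨β₁, β₂, hβ₁𝔞, hβ₂𝔞, ((b₁ : 𝓞 F) : F) / ((β₁ : 𝓞 F) : F), ((b₂ : 𝓞 F) : F) / ((β₁ : 𝓞 F) : F), ?_,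
    hint b₁ hb₁, hint b₂ hb₂⟩
  field_simp
  linear_combination hsumF

/-! ### §2 The idèle `z` of `𝔞⁻¹`: local absolute values, `𝔞·z ⊆ 𝓞̂_F`, `z⁻¹ ∈ 𝓞̂_F·𝔞` -/

omit [IsCMField F] in
/-- `|z_v|_v = |𝔞|_v⁻¹ = exp(ord_v 𝔞)` when `[z] = 𝔞⁻¹` (★ `count_toFractionalIdeal`, Mathlib `FractionalIdeal.count_inv`). [cite: CasselsFrohlichANT1967, Ch. II §17] -/
theorem valued_apply_eq_exp_count_of_toFractionalIdeal_eq_inv (z : (FiniteAdeleRing (𝓞 F) F)ˣ) (𝔞 : Ideal (𝓞 F))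
    (hz : toFractionalIdeal (𝓞 F) F z = ((𝔞 : FractionalIdeal (𝓞 F)⁰ F))⁻¹) (v : HeightOneSpectrum (𝓞 F)) :
    Valued.v ((z : FiniteAdeleRing (𝓞 F) F) v) = WithZero.exp (FractionalIdeal.count F v (𝔞 : FractionalIdeal (𝓞 F)⁰ F)) := by
  have h := count_toFractionalIdeal (R := 𝓞 F) (K := F) z v
  rw [hz, FractionalIdeal.count_inv] at h
  rw [valued_apply_eq_exp_neg_unitOrd, ← h, neg_neg]

omit [IsCMField F] in
/-- **`𝔞·z ⊆ 𝓞̂_F`**: for `x ∈ 𝔞` the adèle `x z` is integral (`|x|_v ≤ |𝔞|_v`, ★ `mem_iff_forall_valuation_le`). [cite: Shimura1998, §18.3 p. 122]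
[cite: CasselsFrohlichANT1967, Ch. II §17] -/
theorem algebraMap_mul_mem_integralFiniteAdeles_of_mem (z : (FiniteAdeleRing (𝓞 F) F)ˣ) (𝔞 : Ideal (𝓞 F)) (h𝔞 : 𝔞 ≠ ⊥)
    (hz : toFractionalIdeal (𝓞 F) F z = ((𝔞 : FractionalIdeal (𝓞 F)⁰ F))⁻¹) {x : 𝓞 F} (hx : x ∈ 𝔞) :
    algebraMap F (FiniteAdeleRing (𝓞 F) F) ((x : 𝓞 F) : F) * (z : FiniteAdeleRing (𝓞 F) F) ∈ integralFiniteAdeles F := by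
  have h𝔞0 : (𝔞 : FractionalIdeal (𝓞 F)⁰ F) ≠ 0 := FractionalIdeal.coeIdeal_ne_zero.2 h𝔞
  have hxmem : ((x : 𝓞 F) : F) ∈ (𝔞 : FractionalIdeal (𝓞 F)⁰ F) := (FractionalIdeal.mem_coeIdeal (𝓞 F)⁰).2 ⟨x, hx, rfl⟩
  rw [mem_integralFiniteAdeles_iff]
  intro v
  have hle := (Literature.NumberTheory.NumberFields.mem_iff_forall_valuation_le h𝔞0 _).1 hxmem v
  rw [HeightOneSpectrum.mem_adicCompletionIntegers, show (algebraMap F (FiniteAdeleRing (𝓞 F) F) ((x : 𝓞 F) : F) *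
      (z : FiniteAdeleRing (𝓞 F) F)) v = (algebraMap F (FiniteAdeleRing (𝓞 F) F) ((x : 𝓞 F) : F)) v * (z : FiniteAdeleRing (𝓞 F) F) v from rfl,
    map_mul, valued_apply_eq_exp_count_of_toFractionalIdeal_eq_inv z 𝔞 hz v,
    show (algebraMap F (FiniteAdeleRing (𝓞 F) F) ((x : 𝓞 F) : F)) v = (((x : 𝓞 F) : F) : v.adicCompletion F) from rfl,
    HeightOneSpectrum.valuedAdicCompletion_eq_valuation']
  calc v.valuation F ((x : 𝓞 F) : F) * WithZero.exp (FractionalIdeal.count F v (𝔞 : FractionalIdeal (𝓞 F)⁰ F))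
      ≤ WithZero.exp (-FractionalIdeal.count F v (𝔞 : FractionalIdeal (𝓞 F)⁰ F)) *
          WithZero.exp (FractionalIdeal.count F v (𝔞 : FractionalIdeal (𝓞 F)⁰ F)) := mul_le_mul' hle le_rfl
    _ = 1 := by rw [← WithZero.exp_add, neg_add_cancel, WithZero.exp_zero]

omit [IsCMField F] in
/-- `|z⁻¹_v|_v = |𝔞|_v = exp(−ord_v 𝔞)` when `[z] = 𝔞⁻¹`. [cite: CasselsFrohlichANT1967, Ch. II §17] -/
theorem valued_inv_apply_eq_exp_neg_count_of_toFractionalIdeal_eq_inv (z : (FiniteAdeleRing (𝓞 F) F)ˣ) (𝔞 : Ideal (𝓞 F))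
    (hz : toFractionalIdeal (𝓞 F) F z = ((𝔞 : FractionalIdeal (𝓞 F)⁰ F))⁻¹) (v : HeightOneSpectrum (𝓞 F)) :
    Valued.v (((z⁻¹ : (FiniteAdeleRing (𝓞 F) F)ˣ) : FiniteAdeleRing (𝓞 F) F) v) =
      WithZero.exp (-FractionalIdeal.count F v (𝔞 : FractionalIdeal (𝓞 F)⁰ F)) := by
  have hprod := congrArg Valued.v (val_apply_mul_inv_apply z v)
  rw [map_mul, map_one, valued_apply_eq_exp_count_of_toFractionalIdeal_eq_inv z 𝔞 hz v] at hprod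
  calc Valued.v (((z⁻¹ : (FiniteAdeleRing (𝓞 F) F)ˣ) : FiniteAdeleRing (𝓞 F) F) v)
      = WithZero.exp (-FractionalIdeal.count F v (𝔞 : FractionalIdeal (𝓞 F)⁰ F)) *
          (WithZero.exp (FractionalIdeal.count F v (𝔞 : FractionalIdeal (𝓞 F)⁰ F)) *
            Valued.v (((z⁻¹ : (FiniteAdeleRing (𝓞 F) F)ˣ) : FiniteAdeleRing (𝓞 F) F) v)) := by
        rw [← mul_assoc, ← WithZero.exp_add, neg_add_cancel, WithZero.exp_zero, one_mul]
    _ = WithZero.exp (-FractionalIdeal.count F v (𝔞 : FractionalIdeal (𝓞 F)⁰ F)) := by rw [hprod, mul_one]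

omit [IsCMField F] in
/-- **`z⁻¹ ∈ 𝓞̂_F`** when `[z] = 𝔞⁻¹` with `𝔞` integral (`|z⁻¹_v| = |𝔞|_v ≤ 1`). [cite: Shimura1998, §18.3 p. 122] [cite: CasselsFrohlichANT1967, Ch. II §17] -/
theorem inv_mem_integralFiniteAdeles_of_toFractionalIdeal_eq_inv (z : (FiniteAdeleRing (𝓞 F) F)ˣ) (𝔞 : Ideal (𝓞 F))
    (hz : toFractionalIdeal (𝓞 F) F z = ((𝔞 : FractionalIdeal (𝓞 F)⁰ F))⁻¹) :
    ((z⁻¹ : (FiniteAdeleRing (𝓞 F) F)ˣ) : FiniteAdeleRing (𝓞 F) F) ∈ integralFiniteAdeles F := by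
  rw [mem_integralFiniteAdeles_iff]
  intro v
  rw [HeightOneSpectrum.mem_adicCompletionIntegers, valued_inv_apply_eq_exp_neg_count_of_toFractionalIdeal_eq_inv z 𝔞 hz v, ← WithZero.exp_zero]
  exact WithZero.exp_le_exp.2 (neg_nonpos.2 (FractionalIdeal.count_coe_nonneg F v 𝔞))

omit [IsCMField F] in
/-- **`z⁻¹ ∈ 𝓞̂_F·𝔞` EXPLICITLY**: `z⁻¹ = s₁β₁ + s₂β₂` with `βₖ ∈ 𝔞` and integral adèles `sₖ` (`sₖ = cₖ z⁻¹` for the inverse pair of §1: `|cₖ|_v ≤ |𝔞|_v⁻¹` since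
`cₖ ∈ 𝔞⁻¹`, ★ `mem_iff_forall_valuation_le`) — «`(𝔞⁻¹)⁻¹𝓞̂ = 𝔞𝓞̂` is generated by two global elements». [cite: Shimura1998, §18.3 p. 122]
[cite: CasselsFrohlichANT1967, Ch. II §17] [cite: NeukirchANT1999, Ch. I Cor. (3.9)] -/
theorem exists_inv_eq_add_mul_of_toFractionalIdeal_eq_inv (z : (FiniteAdeleRing (𝓞 F) F)ˣ) (𝔞 : Ideal (𝓞 F)) (h𝔞 : 𝔞 ≠ ⊥)
    (hz : toFractionalIdeal (𝓞 F) F z = ((𝔞 : FractionalIdeal (𝓞 F)⁰ F))⁻¹) :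
    ∃ β₁ β₂ : 𝓞 F, β₁ ∈ 𝔞 ∧ β₂ ∈ 𝔞 ∧ ∃ s₁ s₂ : FiniteAdeleRing (𝓞 F) F, s₁ ∈ integralFiniteAdeles F ∧ s₂ ∈ integralFiniteAdeles F ∧
      ((z⁻¹ : (FiniteAdeleRing (𝓞 F) F)ˣ) : FiniteAdeleRing (𝓞 F) F) =
        s₁ * algebraMap F (FiniteAdeleRing (𝓞 F) F) ((β₁ : 𝓞 F) : F) + s₂ * algebraMap F (FiniteAdeleRing (𝓞 F) F) ((β₂ : 𝓞 F) : F) := by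
  have h𝔞0 : (𝔞 : FractionalIdeal (𝓞 F)⁰ F) ≠ 0 := FractionalIdeal.coeIdeal_ne_zero.2 h𝔞
  obtain ⟨β₁, β₂, hβ₁, hβ₂, c₁, c₂, hsum, hc₁, hc₂⟩ := exists_pair_mem_and_inverse_pair 𝔞 h𝔞
  -- `cₖ ∈ 𝔞⁻¹`, hence `|cₖ|_v ≤ |𝔞|_v⁻¹`
  have hinv : ∀ c : F, (∀ x ∈ 𝔞, ∃ d : 𝓞 F, (d : F) = c * ((x : 𝓞 F) : F)) →
      ∀ v : HeightOneSpectrum (𝓞 F), v.valuation F c ≤ WithZero.exp (FractionalIdeal.count F v (𝔞 : FractionalIdeal (𝓞 F)⁰ F)) := by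
    intro c hc v
    have hmem : c ∈ ((𝔞 : FractionalIdeal (𝓞 F)⁰ F))⁻¹ := by
      refine (FractionalIdeal.mem_inv_iff h𝔞0).2 fun y hy => ?_
      obtain ⟨y', hy', rfl⟩ := (FractionalIdeal.mem_coeIdeal (𝓞 F)⁰).1 hy
      obtain ⟨d, hd⟩ := hc y' hy'
      exact (FractionalIdeal.mem_one_iff (𝓞 F)⁰).2 ⟨d, hd⟩
    have h := (Literature.NumberTheory.NumberFields.mem_iff_forall_valuation_le (inv_ne_zero h𝔞0) c).1 hmem v
    rwa [FractionalIdeal.count_inv, neg_neg] at h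
  -- `sₖ := cₖ z⁻¹ ∈ 𝓞̂_F`
  have hs : ∀ c : F, (∀ x ∈ 𝔞, ∃ d : 𝓞 F, (d : F) = c * ((x : 𝓞 F) : F)) →
      algebraMap F (FiniteAdeleRing (𝓞 F) F) c * ((z⁻¹ : (FiniteAdeleRing (𝓞 F) F)ˣ) : FiniteAdeleRing (𝓞 F) F) ∈ integralFiniteAdeles F := by
    intro c hc
    rw [mem_integralFiniteAdeles_iff]
    intro v
    rw [HeightOneSpectrum.mem_adicCompletionIntegers, show (algebraMap F (FiniteAdeleRing (𝓞 F) F) c *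
        ((z⁻¹ : (FiniteAdeleRing (𝓞 F) F)ˣ) : FiniteAdeleRing (𝓞 F) F)) v =
        (algebraMap F (FiniteAdeleRing (𝓞 F) F) c) v * ((z⁻¹ : (FiniteAdeleRing (𝓞 F) F)ˣ) : FiniteAdeleRing (𝓞 F) F) v from rfl,
      map_mul, valued_inv_apply_eq_exp_neg_count_of_toFractionalIdeal_eq_inv z 𝔞 hz v,
      show (algebraMap F (FiniteAdeleRing (𝓞 F) F) c) v = ((c : F) : v.adicCompletion F) from rfl,
      HeightOneSpectrum.valuedAdicCompletion_eq_valuation']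
    calc v.valuation F c * WithZero.exp (-FractionalIdeal.count F v (𝔞 : FractionalIdeal (𝓞 F)⁰ F))
        ≤ WithZero.exp (FractionalIdeal.count F v (𝔞 : FractionalIdeal (𝓞 F)⁰ F)) *
            WithZero.exp (-FractionalIdeal.count F v (𝔞 : FractionalIdeal (𝓞 F)⁰ F)) := mul_le_mul' (hinv c hc v) le_rfl
      _ = 1 := by rw [← WithZero.exp_add, add_neg_cancel, WithZero.exp_zero]
  have hsumA : algebraMap F (FiniteAdeleRing (𝓞 F) F) c₁ * algebraMap F (FiniteAdeleRing (𝓞 F) F) ((β₁ : 𝓞 F) : F) +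
      algebraMap F (FiniteAdeleRing (𝓞 F) F) c₂ * algebraMap F (FiniteAdeleRing (𝓞 F) F) ((β₂ : 𝓞 F) : F) = 1 := by
    rw [← map_mul, ← map_mul, ← map_add, hsum, map_one]
  refine ⟨β₁, β₂, hβ₁, hβ₂, algebraMap F (FiniteAdeleRing (𝓞 F) F) c₁ * ((z⁻¹ : (FiniteAdeleRing (𝓞 F) F)ˣ) : FiniteAdeleRing (𝓞 F) F),
    algebraMap F (FiniteAdeleRing (𝓞 F) F) c₂ * ((z⁻¹ : (FiniteAdeleRing (𝓞 F) F)ˣ) : FiniteAdeleRing (𝓞 F) F), hs c₁ hc₁, hs c₂ hc₂, ?_⟩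
  linear_combination (-(((z⁻¹ : (FiniteAdeleRing (𝓞 F) F)ˣ) : FiniteAdeleRing (𝓞 F) F))) * hsumA

/-! ### §3 The framed scalar: multiplicativity, commutation with the carrier, and the CORE on an adelic vector -/

/-- The framed scalar `y ↦ P_𝔸·res(y•1)·Q_𝔸` is multiplicative (`Q_𝔸P_𝔸 = 1`). [cite: Milne2005ShimuraVarieties, §6 p. 67] -/
theorem frameScalar_mul (Fr : SymplecticFrameV F (RingHom.id F) Jstar ξ g δ) (y y' : finAdeleQ ⊗[ℚ] F) :
    framePVR finAdeleQ Fr * resMatrix (m := Fin 2) (Algebra.TensorProduct.basis finAdeleQ (ratBasis F))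
        ((y * y') • (1 : Matrix (Fin 2) (Fin 2) (finAdeleQ ⊗[ℚ] F))) * frameQVR finAdeleQ Fr =
      (framePVR finAdeleQ Fr * resMatrix (m := Fin 2) (Algebra.TensorProduct.basis finAdeleQ (ratBasis F))
          (y • (1 : Matrix (Fin 2) (Fin 2) (finAdeleQ ⊗[ℚ] F))) * frameQVR finAdeleQ Fr) *
        (framePVR finAdeleQ Fr * resMatrix (m := Fin 2) (Algebra.TensorProduct.basis finAdeleQ (ratBasis F))
          (y' • (1 : Matrix (Fin 2) (Fin 2) (finAdeleQ ⊗[ℚ] F))) * frameQVR finAdeleQ Fr) := by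
  have h1 : (y * y') • (1 : Matrix (Fin 2) (Fin 2) (finAdeleQ ⊗[ℚ] F)) =
      (y • (1 : Matrix (Fin 2) (Fin 2) (finAdeleQ ⊗[ℚ] F))) * (y' • (1 : Matrix (Fin 2) (Fin 2) (finAdeleQ ⊗[ℚ] F))) := by
    rw [Matrix.smul_mul, Matrix.one_mul, smul_smul]
  rw [h1, map_mul]
  symm
  calc framePVR finAdeleQ Fr * resMatrix (m := Fin 2) (Algebra.TensorProduct.basis finAdeleQ (ratBasis F))
          (y • (1 : Matrix (Fin 2) (Fin 2) (finAdeleQ ⊗[ℚ] F))) * frameQVR finAdeleQ Fr *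
        (framePVR finAdeleQ Fr * resMatrix (m := Fin 2) (Algebra.TensorProduct.basis finAdeleQ (ratBasis F))
          (y' • (1 : Matrix (Fin 2) (Fin 2) (finAdeleQ ⊗[ℚ] F))) * frameQVR finAdeleQ Fr)
      = framePVR finAdeleQ Fr * resMatrix (m := Fin 2) (Algebra.TensorProduct.basis finAdeleQ (ratBasis F))
          (y • (1 : Matrix (Fin 2) (Fin 2) (finAdeleQ ⊗[ℚ] F))) * (frameQVR finAdeleQ Fr * framePVR finAdeleQ Fr) *
          resMatrix (m := Fin 2) (Algebra.TensorProduct.basis finAdeleQ (ratBasis F))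
            (y' • (1 : Matrix (Fin 2) (Fin 2) (finAdeleQ ⊗[ℚ] F))) * frameQVR finAdeleQ Fr := by
        simp only [Matrix.mul_assoc]
    _ = _ := by rw [frameQVR_mul_framePVR, Matrix.mul_one]; simp only [Matrix.mul_assoc]

/-- The framed scalar commutes with the carrier `ũ_β(p)` (scalars are central in `M_n(𝔸_{ℚ,f} ⊗ F)`). [cite: Deligne1979ShimuraVarieties, Prop. 2.3.10 (PDF p. 32)] -/
theorem coe_auxToGspFinV_mul_frameScalar (Fr : SymplecticFrameV F (RingHom.id F) Jstar ξ g δ)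
    (p : ↥(finAdelic (↥(maximalRealSubfield F)) F (IsCMField.complexConj F) 2 Jstar) × ↥(torusFinAdelic F)) (y : finAdeleQ ⊗[ℚ] F) :
    ((auxToGspFinV Fr p : GL (Fin g ⊕ Fin g) finAdeleQ) : Matrix (Fin g ⊕ Fin g) (Fin g ⊕ Fin g) finAdeleQ) *
        (framePVR finAdeleQ Fr * resMatrix (m := Fin 2) (Algebra.TensorProduct.basis finAdeleQ (ratBasis F))
          (y • (1 : Matrix (Fin 2) (Fin 2) (finAdeleQ ⊗[ℚ] F))) * frameQVR finAdeleQ Fr) =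
      (framePVR finAdeleQ Fr * resMatrix (m := Fin 2) (Algebra.TensorProduct.basis finAdeleQ (ratBasis F))
          (y • (1 : Matrix (Fin 2) (Fin 2) (finAdeleQ ⊗[ℚ] F))) * frameQVR finAdeleQ Fr) *
        ((auxToGspFinV Fr p : GL (Fin g ⊕ Fin g) finAdeleQ) : Matrix (Fin g ⊕ Fin g) (Fin g ⊕ Fin g) finAdeleQ) := by
  rw [coe_auxToGspFinV_eq, coe_auxResFinV]
  set B : Matrix (Fin 2) (Fin 2) (finAdeleQ ⊗[ℚ] F) :=
    ((blockGLV (finAdeleQ ⊗[ℚ] F) (torusToTensorFin F p.2, unitaryToTensorFin F (RingHom.id F) Jstar p.1) : GL (Fin 2) (finAdeleQ ⊗[ℚ] F)) :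
      Matrix (Fin 2) (Fin 2) (finAdeleQ ⊗[ℚ] F)) with hB
  have hc : B * (y • (1 : Matrix (Fin 2) (Fin 2) (finAdeleQ ⊗[ℚ] F))) = (y • (1 : Matrix (Fin 2) (Fin 2) (finAdeleQ ⊗[ℚ] F))) * B := by
    rw [Matrix.mul_smul, Matrix.mul_one, Matrix.smul_mul, Matrix.one_mul]
  have conj : ∀ X Y : Matrix (Fin 2) (Fin 2) (finAdeleQ ⊗[ℚ] F),
      framePVR finAdeleQ Fr * resMatrix (m := Fin 2) (Algebra.TensorProduct.basis finAdeleQ (ratBasis F)) X * frameQVR finAdeleQ Fr *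
        (framePVR finAdeleQ Fr * resMatrix (m := Fin 2) (Algebra.TensorProduct.basis finAdeleQ (ratBasis F)) Y * frameQVR finAdeleQ Fr) =
      framePVR finAdeleQ Fr * resMatrix (m := Fin 2) (Algebra.TensorProduct.basis finAdeleQ (ratBasis F)) (X * Y) * frameQVR finAdeleQ Fr := by
    intro X Y
    calc framePVR finAdeleQ Fr * resMatrix (m := Fin 2) (Algebra.TensorProduct.basis finAdeleQ (ratBasis F)) X * frameQVR finAdeleQ Fr *
          (framePVR finAdeleQ Fr * resMatrix (m := Fin 2) (Algebra.TensorProduct.basis finAdeleQ (ratBasis F)) Y * frameQVR finAdeleQ Fr)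
        = framePVR finAdeleQ Fr * resMatrix (m := Fin 2) (Algebra.TensorProduct.basis finAdeleQ (ratBasis F)) X *
            (frameQVR finAdeleQ Fr * framePVR finAdeleQ Fr) *
            resMatrix (m := Fin 2) (Algebra.TensorProduct.basis finAdeleQ (ratBasis F)) Y * frameQVR finAdeleQ Fr := by
          simp only [Matrix.mul_assoc]
      _ = _ := by rw [frameQVR_mul_framePVR, Matrix.mul_one, map_mul]; simp only [Matrix.mul_assoc]
  rw [conj, conj, hc]

/-- **CORE OF (K) ON AN ADELIC VECTOR**: for the idèle `z` of `𝔞⁻¹` and ANY `y ∈ 𝔸_{ℚ,f}^{2g}`, `P_𝔸·res((e⁻¹z⁻¹)•1)·Q_𝔸·y ∈ ẑ^{2g} ↔ ∀ x ∈ 𝔞, (ρ x)·y ∈ ẑ^{2g}`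
(⇒: `x·1 = (x z)·z⁻¹` with `x z ∈ 𝓞̂_F` acting integrally, ★ `frameScalar_integral_of_mem_integralFiniteAdeles`; ⇐: `z⁻¹ = s₁β₁ + s₂β₂`, §2).
[cite: Shimura1998, §18.3 pp. 122–123, §18.6 proof p. 127] [cite: Milne2005ShimuraVarieties, §4 pp. 48–49] -/
theorem forall_frameScalar_inv_mulVec_integral_iff (Fr : SymplecticFrameV F (RingHom.id F) Jstar ξ g δ)
    (ρ : 𝓞 F →+* Matrix (Fin g ⊕ Fin g) (Fin g ⊕ Fin g) ℤ)
    (hρ : ∀ b : 𝓞 F, (ρ b).map (Int.cast : ℤ → ℚ) =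
      framePV Fr * resMatrix (m := Fin 2) (ratBasis F) (((b : 𝓞 F) : F) • (1 : Matrix (Fin 2) (Fin 2) F)) * frameQV Fr)
    (z : (FiniteAdeleRing (𝓞 F) F)ˣ) (𝔞 : Ideal (𝓞 F)) (h𝔞 : 𝔞 ≠ ⊥)
    (hz : toFractionalIdeal (𝓞 F) F z = ((𝔞 : FractionalIdeal (𝓞 F)⁰ F))⁻¹) (y : Fin g ⊕ Fin g → finAdeleQ) :
    (∀ i, ((framePVR finAdeleQ Fr * resMatrix (m := Fin 2) (Algebra.TensorProduct.basis finAdeleQ (ratBasis F))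
        (((ratFiniteAdeleTensorEquiv F).symm ((z⁻¹ : (FiniteAdeleRing (𝓞 F) F)ˣ) : FiniteAdeleRing (𝓞 F) F)) •
          (1 : Matrix (Fin 2) (Fin 2) (finAdeleQ ⊗[ℚ] F))) * frameQVR finAdeleQ Fr) *ᵥ y) i ∈ integralFiniteAdeles ℚ) ↔
    ∀ x ∈ 𝔞, ∀ i, ((ρ x).map (Int.cast : ℤ → finAdeleQ) *ᵥ y) i ∈ integralFiniteAdeles ℚ := by
  classical
  have hmv : ∀ {M : Matrix (Fin g ⊕ Fin g) (Fin g ⊕ Fin g) finAdeleQ} {u : Fin g ⊕ Fin g → finAdeleQ},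
      (∀ i k, M i k ∈ integralFiniteAdeles ℚ) → (∀ i, u i ∈ integralFiniteAdeles ℚ) → ∀ i, (M *ᵥ u) i ∈ integralFiniteAdeles ℚ := by
    intro M u hM hu i
    rw [Matrix.mulVec, dotProduct]
    exact sum_mem fun k _ => mul_mem (hM i k) (hu k)
  -- the reading of `x ∈ 𝓞_F` is the framed scalar of `1 ⊗ x = e⁻¹ x`
  have hread : ∀ x : 𝓞 F, (ρ x).map (Int.cast : ℤ → finAdeleQ) =
      framePVR finAdeleQ Fr * resMatrix (m := Fin 2) (Algebra.TensorProduct.basis finAdeleQ (ratBasis F))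
        (((ratFiniteAdeleTensorEquiv F).symm (algebraMap F (FiniteAdeleRing (𝓞 F) F) ((x : 𝓞 F) : F))) •
          (1 : Matrix (Fin 2) (Fin 2) (finAdeleQ ⊗[ℚ] F))) * frameQVR finAdeleQ Fr := fun x => by
    rw [ratFiniteAdeleTensorEquiv_symm_algebraMap, frameScalar_one_tmul_eq_map_reading Fr ρ hρ]
  constructor
  · intro h x hx i
    -- `x = (x z) · z⁻¹`
    have hxz : algebraMap F (FiniteAdeleRing (𝓞 F) F) ((x : 𝓞 F) : F) =
        (algebraMap F (FiniteAdeleRing (𝓞 F) F) ((x : 𝓞 F) : F) * (z : FiniteAdeleRing (𝓞 F) F)) *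
          ((z⁻¹ : (FiniteAdeleRing (𝓞 F) F)ˣ) : FiniteAdeleRing (𝓞 F) F) := by
      rw [mul_assoc, ← Units.val_mul, mul_inv_cancel, Units.val_one, mul_one]
    rw [hread, hxz, map_mul, frameScalar_mul, ← Matrix.mulVec_mulVec]
    exact hmv (frameScalar_integral_of_mem_integralFiniteAdeles Fr ρ hρ (algebraMap_mul_mem_integralFiniteAdeles_of_mem z 𝔞 h𝔞 hz hx)) h i
  · intro h i
    obtain ⟨β₁, β₂, hβ₁, hβ₂, s₁, s₂, hs₁, hs₂, hzinv⟩ := exists_inv_eq_add_mul_of_toFractionalIdeal_eq_inv z 𝔞 h𝔞 hz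
    rw [hzinv, map_add, map_mul, map_mul, frameScalar_add, frameScalar_mul, frameScalar_mul, ← hread, ← hread, Matrix.add_mulVec,
      Pi.add_apply]
    exact add_mem
      (by rw [← Matrix.mulVec_mulVec]; exact hmv (frameScalar_integral_of_mem_integralFiniteAdeles Fr ρ hρ hs₁) (h β₁ hβ₁) i)
      (by rw [← Matrix.mulVec_mulVec]; exact hmv (frameScalar_integral_of_mem_integralFiniteAdeles Fr ρ hρ hs₂) (h β₂ hβ₂) i)

/-! ### §4 HEAD (K): the torus-leg lattice identity -/

/-- **(K) THE TORUS-LEG LATTICE IDENTITY `Λ_{r′·ũ_β(1,z)} = 𝔞⁻¹·Λ_{r′}`.**  In an `𝓞_F`-stable symplectic frame `Fr` with integral reading `ρ`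
(`(ρ b)_ℚ = P·res(b•1)·Q`, the `ρ₀`-conjunct of the chart pin), for ANY adelic point `p` of `U(J⋆) × T₀`, `r′ := ũ_β(p)`, and a central idèle `z ∈ T₀(F)(𝔸_f)`
whose ideal is `𝔞⁻¹` (`[z] = 𝔞⁻¹`, the junction row of ★ `IsSheetTwistOf`): for every rational vector `v`,
`v ∈ Λ_{r′·ũ_β(1,z)} ↔ ∀ x ∈ 𝔞, ρ(x)·v ∈ Λ_{r′}` — Shimura՚s «the lattice of `A ⊗ 𝔞⁻¹` is `𝔞⁻¹Λ`» ∕ «`t𝔞`» on adelic markings, i.e. VERBATIM the hypothesis `hr` of ★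
`SiegelAdelicMarking.exists_marking_of_idealKernel` at `r := r′·ũ_β(1,z)`, `M := (ρ ·)_ℚ`.
[cite: Shimura1998, §18.3 pp. 122–123, §18.6 pp. 124–127] [cite: Milne2005ShimuraVarieties, §4 pp. 48–49, §6 Thm. 6.11 p. 74 and p. 75, Def. 12.8 (60)–(62) p. 114] -/
theorem mem_latticeOfGL_auxToGspFinV_mul_torusLeg_iff (Fr : SymplecticFrameV F (RingHom.id F) Jstar ξ g δ)
    (ρ : 𝓞 F →+* Matrix (Fin g ⊕ Fin g) (Fin g ⊕ Fin g) ℤ)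
    (hρ : ∀ b : 𝓞 F, (ρ b).map (Int.cast : ℤ → ℚ) =
      framePV Fr * resMatrix (m := Fin 2) (ratBasis F) (((b : 𝓞 F) : F) • (1 : Matrix (Fin 2) (Fin 2) F)) * frameQV Fr)
    (p : ↥(finAdelic (↥(maximalRealSubfield F)) F (IsCMField.complexConj F) 2 Jstar) × ↥(torusFinAdelic F))
    (z : ↥(torusFinAdelic F)) (𝔞 : Ideal (𝓞 F)) (h𝔞 : 𝔞 ≠ ⊥)
    (hz : toFractionalIdeal (𝓞 F) F (z : (FiniteAdeleRing (𝓞 F) F)ˣ) = ((𝔞 : FractionalIdeal (𝓞 F)⁰ F))⁻¹)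
    (v : Fin g ⊕ Fin g → ℚ) :
    v ∈ latticeOfGL (((auxToGspFinV Fr p * auxToGspFinV Fr (1, z) : ↥(gspFinAdelic δ)) : GL (Fin g ⊕ Fin g) finAdeleQ)) ↔
      ∀ x ∈ 𝔞, ((ρ x).map (Int.cast : ℤ → ℚ)) *ᵥ v ∈ latticeOfGL ((auxToGspFinV Fr p : ↥(gspFinAdelic δ)) : GL (Fin g ⊕ Fin g) finAdeleQ) := by
  classical
  -- the torus leg inverted is the framed scalar of `e⁻¹ z⁻¹`
  have hleg : ((((auxToGspFinV Fr (1, z) : ↥(gspFinAdelic δ)) : GL (Fin g ⊕ Fin g) finAdeleQ)⁻¹ : GL (Fin g ⊕ Fin g) finAdeleQ) :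
        Matrix (Fin g ⊕ Fin g) (Fin g ⊕ Fin g) finAdeleQ) =
      framePVR finAdeleQ Fr * resMatrix (m := Fin 2) (Algebra.TensorProduct.basis finAdeleQ (ratBasis F))
        (((ratFiniteAdeleTensorEquiv F).symm (((z : (FiniteAdeleRing (𝓞 F) F)ˣ)⁻¹ : (FiniteAdeleRing (𝓞 F) F)ˣ) : FiniteAdeleRing (𝓞 F) F)) •
          (1 : Matrix (Fin 2) (Fin 2) (finAdeleQ ⊗[ℚ] F))) * frameQVR finAdeleQ Fr := by
    rw [← Subgroup.coe_inv, ← map_inv, Prod.inv_mk, inv_one, coe_auxToGspFinV_one_eq_frameScalar, Subgroup.coe_inv]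
  -- the reading through `ℚ → 𝔸_{ℚ,f}` is the integer reading
  have hmap : ∀ x : 𝓞 F, ((ρ x).map (Int.cast : ℤ → ℚ)).map (algebraMap ℚ finAdeleQ) = (ρ x).map (Int.cast : ℤ → finAdeleQ) := by
    intro x
    rw [Matrix.map_map]
    congr 1
    funext n
    simp only [Function.comp_apply, map_intCast]
  -- `ũ(p)⁻¹` commutes with the reading
  have hcomm : ∀ x : 𝓞 F,
      ((((auxToGspFinV Fr p : ↥(gspFinAdelic δ)) : GL (Fin g ⊕ Fin g) finAdeleQ)⁻¹ : GL (Fin g ⊕ Fin g) finAdeleQ) :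
          Matrix (Fin g ⊕ Fin g) (Fin g ⊕ Fin g) finAdeleQ) * (ρ x).map (Int.cast : ℤ → finAdeleQ) =
        (ρ x).map (Int.cast : ℤ → finAdeleQ) *
          ((((auxToGspFinV Fr p : ↥(gspFinAdelic δ)) : GL (Fin g ⊕ Fin g) finAdeleQ)⁻¹ : GL (Fin g ⊕ Fin g) finAdeleQ) :
            Matrix (Fin g ⊕ Fin g) (Fin g ⊕ Fin g) finAdeleQ) := by
    intro x
    have h := coe_auxToGspFinV_mul_frameScalar Fr p ((1 : finAdeleQ) ⊗ₜ[ℚ] ((x : 𝓞 F) : F))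
    rw [frameScalar_one_tmul_eq_map_reading Fr ρ hρ] at h
    set U : GL (Fin g ⊕ Fin g) finAdeleQ := ((auxToGspFinV Fr p : ↥(gspFinAdelic δ)) : GL (Fin g ⊕ Fin g) finAdeleQ) with hU
    calc ((U⁻¹ : GL (Fin g ⊕ Fin g) finAdeleQ) : Matrix (Fin g ⊕ Fin g) (Fin g ⊕ Fin g) finAdeleQ) * (ρ x).map (Int.cast : ℤ → finAdeleQ)
        = ((U⁻¹ : GL (Fin g ⊕ Fin g) finAdeleQ) : Matrix (Fin g ⊕ Fin g) (Fin g ⊕ Fin g) finAdeleQ) *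
            ((ρ x).map (Int.cast : ℤ → finAdeleQ) * (U : Matrix (Fin g ⊕ Fin g) (Fin g ⊕ Fin g) finAdeleQ)) *
            ((U⁻¹ : GL (Fin g ⊕ Fin g) finAdeleQ) : Matrix (Fin g ⊕ Fin g) (Fin g ⊕ Fin g) finAdeleQ) := by
          rw [Matrix.mul_assoc, Matrix.mul_assoc, ← Units.val_mul, mul_inv_cancel, Units.val_one, Matrix.mul_one]
      _ = _ := by rw [← h, ← Matrix.mul_assoc, ← Units.val_mul, inv_mul_cancel, Units.val_one, Matrix.one_mul]
  -- both sides read on `y := ũ(p)⁻¹ v`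
  have e1 : v ∈ latticeOfGL (((auxToGspFinV Fr p * auxToGspFinV Fr (1, z) : ↥(gspFinAdelic δ)) : GL (Fin g ⊕ Fin g) finAdeleQ)) ↔
      ∀ i, ((framePVR finAdeleQ Fr * resMatrix (m := Fin 2) (Algebra.TensorProduct.basis finAdeleQ (ratBasis F))
        (((ratFiniteAdeleTensorEquiv F).symm (((z : (FiniteAdeleRing (𝓞 F) F)ˣ)⁻¹ : (FiniteAdeleRing (𝓞 F) F)ˣ) : FiniteAdeleRing (𝓞 F) F)) •
          (1 : Matrix (Fin 2) (Fin 2) (finAdeleQ ⊗[ℚ] F))) * frameQVR finAdeleQ Fr) *ᵥ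
        (((((auxToGspFinV Fr p : ↥(gspFinAdelic δ)) : GL (Fin g ⊕ Fin g) finAdeleQ)⁻¹ : GL (Fin g ⊕ Fin g) finAdeleQ) :
            Matrix (Fin g ⊕ Fin g) (Fin g ⊕ Fin g) finAdeleQ) *ᵥ (⇑(algebraMap ℚ finAdeleQ) ∘ v))) i ∈ integralFiniteAdeles ℚ := by
    rw [mem_latticeOfGL_iff, Subgroup.coe_mul, _root_.mul_inv_rev, Units.val_mul, hleg, ← Matrix.mulVec_mulVec]
  have e2 : ∀ x : 𝓞 F, ((ρ x).map (Int.cast : ℤ → ℚ)) *ᵥ v ∈ latticeOfGL ((auxToGspFinV Fr p : ↥(gspFinAdelic δ)) : GL (Fin g ⊕ Fin g) finAdeleQ) ↔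
      ∀ i, ((ρ x).map (Int.cast : ℤ → finAdeleQ) *ᵥ
        (((((auxToGspFinV Fr p : ↥(gspFinAdelic δ)) : GL (Fin g ⊕ Fin g) finAdeleQ)⁻¹ : GL (Fin g ⊕ Fin g) finAdeleQ) :
            Matrix (Fin g ⊕ Fin g) (Fin g ⊕ Fin g) finAdeleQ) *ᵥ (⇑(algebraMap ℚ finAdeleQ) ∘ v))) i ∈ integralFiniteAdeles ℚ := by
    intro x
    have hv : (⇑(algebraMap ℚ finAdeleQ) ∘ (((ρ x).map (Int.cast : ℤ → ℚ)) *ᵥ v)) = (ρ x).map (Int.cast : ℤ → finAdeleQ) *ᵥ (⇑(algebraMap ℚ finAdeleQ) ∘ v) := by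
      funext i
      rw [← hmap]
      exact RingHom.map_mulVec (algebraMap ℚ finAdeleQ) _ v i
    rw [mem_latticeOfGL_iff, hv, Matrix.mulVec_mulVec, hcomm x, ← Matrix.mulVec_mulVec]
  rw [e1]
  exact (forall_frameScalar_inv_mulVec_integral_iff Fr ρ hρ (z : (FiniteAdeleRing (𝓞 F) F)ˣ) 𝔞 h𝔞 hz _).trans
    (forall₂_congr fun x _ => (e2 x).symm)


/-! ### §5 (ED. 2) The junction feeders: `z⁻¹ ≡ 1 (mod N·𝓞̂_F)`, `ũ_β(1,z⁻¹) ≡ 1 (mod N)`, `n·ũ_β(1,z)` integral -/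

open Literature.NumberTheory.GaloisRepresentations (modulusExp)

omit [IsCMField F] in
/-- `|N|_v = exp(−ν_v(N))` for a non-zero natural number `N` (`ν_v(N)` = ★ `modulusExp (N) v`). [cite: NeukirchANT1999, Ch. I (3.1)] -/
private theorem valuation_natCast_eq_exp_neg_modulusExp {N : ℕ} (hN : N ≠ 0) (v : HeightOneSpectrum (𝓞 F)) :
    v.valuation F ((N : ℕ) : F) = WithZero.exp (-(modulusExp (Ideal.span {((N : ℕ) : 𝓞 F)}) v : ℤ)) := by
  have hN' : ((N : ℕ) : 𝓞 F) ≠ 0 := Nat.cast_ne_zero.2 hN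
  rw [show ((N : ℕ) : F) = algebraMap (𝓞 F) F ((N : ℕ) : 𝓞 F) by rw [map_natCast], HeightOneSpectrum.valuation_of_algebraMap,
    HeightOneSpectrum.intValuation_if_neg _ hN']
  rfl

omit [IsCMField F] in
/-- `|N|_v = 1` at a place `v ∤ N`. [cite: NeukirchANT1999, Ch. I (3.1)] -/
private theorem valuation_natCast_eq_one_of_not_le {N : ℕ} {v : HeightOneSpectrum (𝓞 F)} (hv : ¬ Ideal.span {((N : ℕ) : 𝓞 F)} ≤ v.asIdeal) :
    v.valuation F ((N : ℕ) : F) = 1 := by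
  have hv' : ((N : ℕ) : 𝓞 F) ∉ v.asIdeal := fun h => hv ((Ideal.span_singleton_le_iff_mem _).2 h)
  rw [show ((N : ℕ) : F) = algebraMap (𝓞 F) F ((N : ℕ) : 𝓞 F) by rw [map_natCast], HeightOneSpectrum.valuation_of_algebraMap]
  exact le_antisymm (HeightOneSpectrum.intValuation_le_one v _)
    (not_lt.1 fun h => hv' ((HeightOneSpectrum.intValuation_lt_one_iff_mem v _).1 h))

omit [IsCMField F] in
/-- **`z⁻¹ ≡ 1 (mod N·𝓞̂_F)` FROM THE JUNCTION ROWS.**  If `[z] = 𝔞⁻¹` (`𝔞` integral) and, at every `v ∣ N`, `z_v` is a unit with `|z_v − 1|_v ≤ |N|_v`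
(the congruence rows of ★ `IsSheetTwistOf`, shape of ★ `exists_mul_unitEmbedding_integral_congr`), then `z⁻¹ − 1 = N·u` with `u ∈ 𝓞̂_F`: at `v ∣ N`,
`|z_v⁻¹ − 1| = |z_v − 1| ≤ |N|_v`; at `v ∤ N`, `|N|_v = 1` and `z_v⁻¹ ∈ 𝒪_v`. [cite: Shimura1998, §18.6 proof p. 127] [cite: CasselsFrohlichANT1967, Ch. II §17] -/
theorem exists_inv_sub_one_eq_natCast_mul_of_congr (z : (FiniteAdeleRing (𝓞 F) F)ˣ) (𝔞 : Ideal (𝓞 F))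
    (hz : toFractionalIdeal (𝓞 F) F z = ((𝔞 : FractionalIdeal (𝓞 F)⁰ F))⁻¹) {N : ℕ} (hN : N ≠ 0)
    (hcong : ∀ v : HeightOneSpectrum (𝓞 F), Ideal.span {((N : ℕ) : 𝓞 F)} ≤ v.asIdeal →
      Valued.v ((z : FiniteAdeleRing (𝓞 F) F) v) = 1 ∧ Valued.v ((z : FiniteAdeleRing (𝓞 F) F) v - 1) ≤ WithZero.exp (-(modulusExp (Ideal.span {((N : ℕ) : 𝓞 F)}) v : ℤ))) :
    ∃ u ∈ integralFiniteAdeles F, ((z⁻¹ : (FiniteAdeleRing (𝓞 F) F)ˣ) : FiniteAdeleRing (𝓞 F) F) - 1 = (N : FiniteAdeleRing (𝓞 F) F) * u := by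
  have hNF : ((N : ℕ) : F) ≠ 0 := Nat.cast_ne_zero.2 hN
  have hmul : ∀ (x y : FiniteAdeleRing (𝓞 F) F) (u : HeightOneSpectrum (𝓞 F)), (x * y) u = x u * y u := fun _ _ _ => rfl
  have hsub : ∀ (x y : FiniteAdeleRing (𝓞 F) F) (u : HeightOneSpectrum (𝓞 F)), (x - y) u = x u - y u := fun _ _ _ => rfl
  have hone : ∀ u : HeightOneSpectrum (𝓞 F), (1 : FiniteAdeleRing (𝓞 F) F) u = 1 := fun _ => rfl
  have halg : ∀ (x : F) (u : HeightOneSpectrum (𝓞 F)), (algebraMap F (FiniteAdeleRing (𝓞 F) F) x) u = (x : u.adicCompletion F) := fun _ _ => rfl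
  have hNA : (N : FiniteAdeleRing (𝓞 F) F) = algebraMap F (FiniteAdeleRing (𝓞 F) F) ((N : ℕ) : F) := (map_natCast _ N).symm
  refine ⟨algebraMap F (FiniteAdeleRing (𝓞 F) F) (((N : ℕ) : F)⁻¹) * (((z⁻¹ : (FiniteAdeleRing (𝓞 F) F)ˣ) : FiniteAdeleRing (𝓞 F) F) - 1), ?_, ?_⟩
  · rw [mem_integralFiniteAdeles_iff]
    intro v
    have hzinv : ((z⁻¹ : (FiniteAdeleRing (𝓞 F) F)ˣ) : FiniteAdeleRing (𝓞 F) F) v = ((z : FiniteAdeleRing (𝓞 F) F) v)⁻¹ :=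
      eq_inv_of_mul_eq_one_right (val_apply_mul_inv_apply z v)
    rw [HeightOneSpectrum.mem_adicCompletionIntegers, hmul, halg, hsub, hone, map_mul, HeightOneSpectrum.valuedAdicCompletion_eq_valuation',
      map_inv₀]
    by_cases hv : Ideal.span {((N : ℕ) : 𝓞 F)} ≤ v.asIdeal
    · -- `v ∣ N`: `|z_v⁻¹ − 1| = |z_v|⁻¹ |1 − z_v| ≤ |N|_v`
      obtain ⟨h1, h2⟩ := hcong v hv
      have hz0 : (z : FiniteAdeleRing (𝓞 F) F) v ≠ 0 := Literature.NumberTheory.Automorphic.FiniteAdeleRing.apply_ne_zero z v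
      have heq : ((z⁻¹ : (FiniteAdeleRing (𝓞 F) F)ˣ) : FiniteAdeleRing (𝓞 F) F) v - 1 = ((z : FiniteAdeleRing (𝓞 F) F) v)⁻¹ * (1 - (z : FiniteAdeleRing (𝓞 F) F) v) := by
        rw [hzinv, mul_sub, mul_one, inv_mul_cancel₀ hz0]
      rw [heq, map_mul, map_inv₀, h1, inv_one, one_mul, Valuation.map_sub_swap, valuation_natCast_eq_exp_neg_modulusExp hN v,
        ← WithZero.exp_neg, neg_neg]
      calc WithZero.exp ((modulusExp (Ideal.span {((N : ℕ) : 𝓞 F)}) v : ℤ)) * Valued.v ((z : FiniteAdeleRing (𝓞 F) F) v - 1)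
          ≤ WithZero.exp ((modulusExp (Ideal.span {((N : ℕ) : 𝓞 F)}) v : ℤ)) *
              WithZero.exp (-(modulusExp (Ideal.span {((N : ℕ) : 𝓞 F)}) v : ℤ)) := mul_le_mul' le_rfl h2
        _ = 1 := by rw [← WithZero.exp_add, add_neg_cancel, WithZero.exp_zero]
    · -- `v ∤ N`: `|N|_v = 1`, `z_v⁻¹ ∈ 𝒪_v`
      have hzint := (mem_integralFiniteAdeles_iff.1 (inv_mem_integralFiniteAdeles_of_toFractionalIdeal_eq_inv z 𝔞 hz)) v
      rw [HeightOneSpectrum.mem_adicCompletionIntegers] at hzint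
      rw [valuation_natCast_eq_one_of_not_le hv, inv_one, one_mul]
      exact Valued.v.map_sub_le hzint (by rw [map_one])
  · rw [← mul_assoc, hNA, ← map_mul, mul_inv_cancel₀ hNF, map_one, one_mul]

/-- **(t5) FEEDER: `ũ_β(1, z⁻¹) − 1 ∈ N·M_{2g}(ẑ)`** for the junction idèle `z` (`[z] = 𝔞⁻¹`, congruence rows at `v ∣ N`) — ★ p850156 (hk)
`auxToGspFinV_one_sub_one_of_sub_one_eq_natCast_mul` at `z⁻¹` with §5 `exists_inv_sub_one_eq_natCast_mul_of_congr`; this is the hypothesis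
«`(r⁻¹ r′) − 1 ∈ N·M_{2g}(ẑ)`» of ★ `SiegelAdelicMarking.levelReading_comp_of_congr` for `r = r′·ũ_β(1,z)` (`r⁻¹r′ = ũ_β(1,z)⁻¹ = ũ_β(1,z⁻¹)`).
[cite: Shimura1998, §18.6 proof p. 127] [cite: Milne2005ShimuraVarieties, §6 Thm. 6.11 p. 74 and p. 75] -/
theorem auxToGspFinV_one_inv_sub_one_of_congr (Fr : SymplecticFrameV F (RingHom.id F) Jstar ξ g δ)
    (ρ : 𝓞 F →+* Matrix (Fin g ⊕ Fin g) (Fin g ⊕ Fin g) ℤ)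
    (hρ : ∀ b : 𝓞 F, (ρ b).map (Int.cast : ℤ → ℚ) =
      framePV Fr * resMatrix (m := Fin 2) (ratBasis F) (((b : 𝓞 F) : F) • (1 : Matrix (Fin 2) (Fin 2) F)) * frameQV Fr)
    (z : ↥(torusFinAdelic F)) (𝔞 : Ideal (𝓞 F))
    (hz : toFractionalIdeal (𝓞 F) F (z : (FiniteAdeleRing (𝓞 F) F)ˣ) = ((𝔞 : FractionalIdeal (𝓞 F)⁰ F))⁻¹) {N : ℕ} (hN : N ≠ 0)
    (hcong : ∀ v : HeightOneSpectrum (𝓞 F), Ideal.span {((N : ℕ) : 𝓞 F)} ≤ v.asIdeal →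
      Valued.v (((z : (FiniteAdeleRing (𝓞 F) F)ˣ) : FiniteAdeleRing (𝓞 F) F) v) = 1 ∧
        Valued.v (((z : (FiniteAdeleRing (𝓞 F) F)ˣ) : FiniteAdeleRing (𝓞 F) F) v - 1) ≤ WithZero.exp (-(modulusExp (Ideal.span {((N : ℕ) : 𝓞 F)}) v : ℤ))) :
    ∀ i k, ∃ t ∈ FiniteAdeleRing.integralAdeles (𝓞 ℚ) ℚ,
      (((auxToGspFinV Fr (1, z⁻¹) : GL (Fin g ⊕ Fin g) finAdeleQ) : Matrix (Fin g ⊕ Fin g) (Fin g ⊕ Fin g) finAdeleQ) - 1) i k =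
        (N : finAdeleQ) * t := by
  obtain ⟨u, hu, hzu⟩ := exists_inv_sub_one_eq_natCast_mul_of_congr (z : (FiniteAdeleRing (𝓞 F) F)ˣ) 𝔞 hz hN hcong
  refine auxToGspFinV_one_sub_one_of_sub_one_eq_natCast_mul Fr ρ hρ z⁻¹ N hu ?_
  rw [Subgroup.coe_inv]
  exact hzu

/-- **(t3) FEEDER: `n·ũ_β(1, z) ∈ M_{2g}(ẑ)` for `n ∈ 𝔞`** (row (a) `(n) = 𝔞·c𝔞 ≤ 𝔞`) and `[z] = 𝔞⁻¹` — ★ p850156 (hT) `auxToGspFinV_one_integral_of_natCast_mul_mem`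
with §2 `algebraMap_mul_mem_integralFiniteAdeles_of_mem`; the (H1) input «`ν·T ∈ M_{2g}(ẑ)`», `T = r′⁻¹r = ũ_β(1,z)`, of ★
`SiegelAdelicMarking.pairingReading_comp_of_similitude`. [cite: Shimura1998, §18.6 proof p. 127] [cite: Milne2005ShimuraVarieties, §6 Thm. 6.11 p. 74 and p. 75] -/
theorem auxToGspFinV_one_integral_of_natCast_mem (Fr : SymplecticFrameV F (RingHom.id F) Jstar ξ g δ)
    (ρ : 𝓞 F →+* Matrix (Fin g ⊕ Fin g) (Fin g ⊕ Fin g) ℤ)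
    (hρ : ∀ b : 𝓞 F, (ρ b).map (Int.cast : ℤ → ℚ) =
      framePV Fr * resMatrix (m := Fin 2) (ratBasis F) (((b : 𝓞 F) : F) • (1 : Matrix (Fin 2) (Fin 2) F)) * frameQV Fr)
    (z : ↥(torusFinAdelic F)) (𝔞 : Ideal (𝓞 F)) (h𝔞 : 𝔞 ≠ ⊥)
    (hz : toFractionalIdeal (𝓞 F) F (z : (FiniteAdeleRing (𝓞 F) F)ˣ) = ((𝔞 : FractionalIdeal (𝓞 F)⁰ F))⁻¹) {n : ℕ} (hn : ((n : ℕ) : 𝓞 F) ∈ 𝔞) :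
    ∀ i k, (n : finAdeleQ) *
        ((auxToGspFinV Fr (1, z) : GL (Fin g ⊕ Fin g) finAdeleQ) : Matrix (Fin g ⊕ Fin g) (Fin g ⊕ Fin g) finAdeleQ) i k ∈
      FiniteAdeleRing.integralAdeles (𝓞 ℚ) ℚ := by
  refine auxToGspFinV_one_integral_of_natCast_mul_mem Fr ρ hρ z n ?_
  have h := algebraMap_mul_mem_integralFiniteAdeles_of_mem (z : (FiniteAdeleRing (𝓞 F) F)ˣ) 𝔞 h𝔞 hz hn
  rwa [show (((n : ℕ) : 𝓞 F) : F) = ((n : ℕ) : F) from rfl, map_natCast] at h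


/-! ### §6 (ED. 3) The unit clause `n·q ∈ ẑ^×` for the multiplier `q` of the torus leg (`z z̄ = q`, `[z] = 𝔞⁻¹`, `(n) = 𝔞·c𝔞`) -/

open scoped Pointwise

omit [IsCMField F] in
/-- There is a place of `F` above every rational place (lying over). [cite: NeukirchANT1999, Ch. I §9 (9.1)] -/
private theorem exists_under_eq_rat (p : HeightOneSpectrum (𝓞 ℚ)) : ∃ v : HeightOneSpectrum (𝓞 F), v.under (𝓞 ℚ) = p := by
  haveI : p.asIdeal.IsMaximal := p.isMaximal
  obtain ⟨Q, hQ, hQp⟩ := Ideal.exists_maximal_ideal_liesOver_of_isIntegral (S := 𝓞 F) p.asIdeal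
  exact ⟨⟨Q, hQ.isPrime, Ideal.ne_bot_of_liesOver_of_ne_bot p.ne_bot Q⟩, HeightOneSpectrum.ext hQp.over.symm⟩

/-- A finite idèle of `ℚ` with all valuations `1` is a unit of `ẑ` (twin of ★ `exists_units_integralAdeles_coe_eq`). [cite: CasselsFrohlichANT1967, Ch. II §16] -/
private theorem exists_units_integralAdeles_coe_eq' (u : finAdeleQˣ) (hu : ∀ v, Valued.v ((u : finAdeleQ) v) = 1) :
    ∃ ε : (FiniteAdeleRing.integralAdeles (𝓞 ℚ) ℚ)ˣ, ((ε : FiniteAdeleRing.integralAdeles (𝓞 ℚ) ℚ) : finAdeleQ) = u := by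
  have hu' : ∀ v, Valued.v (((u⁻¹ : finAdeleQˣ) : finAdeleQ) v) = 1 := fun v => by
    have h := congrArg Valued.v (val_apply_mul_inv_apply u v)
    rw [map_mul, map_one, hu v, one_mul] at h
    exact h
  exact ⟨⟨⟨(u : finAdeleQ), Literature.NumberTheory.Adeles.mem_integralAdeles_of_forall_valued_eq_one hu⟩,
    ⟨((u⁻¹ : finAdeleQˣ) : finAdeleQ), Literature.NumberTheory.Adeles.mem_integralAdeles_of_forall_valued_eq_one hu'⟩,
    Subtype.ext u.mul_inv, Subtype.ext u.inv_mul⟩, rfl⟩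

/-- **THE UNIT CLAUSE `n·q ∈ ẑ^×` OF THE TORUS LEG.**  For `z ∈ T₀(F)(𝔸_f)` with `z·z̄ = q` (`q ∈ 𝔸_{ℚ,f}^×` the multiplier of `ũ_β(a,z)`,
★ `isMultiplier_auxToGspFinV`), `[z] = 𝔞⁻¹` and `(n) = 𝔞·c𝔞` (rows of ★ `IsSheetTwistOf`): `n·q = ε` for a unit `ε` of `ẑ` — the binders
`(ε) (hε : ↑ε = ν * μ)` of ★ `SiegelAdelicMarking.pairingReading_comp_of_similitude` at `ν := n`, `μ := q`.  At a place `v ∣ p` of `F`: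
`|z_v|_v|z̄_v|_v = exp(ord_v 𝔞 + ord_{cv} 𝔞) = |n|_v⁻¹` (★ `count_add_count_complexConj_smul_eq`), so `ord_v(con(nq)) = e_v·ord_p(nq) = 0`
(★ `unitOrd_finiteIdeleConorm`) and `e_v ≠ 0`. [cite: Shimura1998, §18.6 proof p. 127] [cite: Milne2005ShimuraVarieties, §6 p. 67 and Thm. 6.11 p. 74]
[cite: CasselsFrohlichANT1967, Ch. II §19 (19.20)–(19.21)] -/
theorem exists_units_integralAdeles_eq_natCast_mul_of_torusLeg (z : ↥(torusFinAdelic F)) (𝔞 : Ideal (𝓞 F))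
    (hz : toFractionalIdeal (𝓞 F) F (z : (FiniteAdeleRing (𝓞 F) F)ˣ) = ((𝔞 : FractionalIdeal (𝓞 F)⁰ F))⁻¹) {n : ℕ} (hn : n ≠ 0)
    (ha : Ideal.span {((n : ℕ) : 𝓞 F)} = 𝔞 * (IsCMField.complexConj F) • 𝔞) (q : finAdeleQˣ)
    (hq : ((z : (FiniteAdeleRing (𝓞 F) F)ˣ) : FiniteAdeleRing (𝓞 F) F) *
        conjFiniteAdele (↥(maximalRealSubfield F)) F (IsCMField.complexConj F) ((z : (FiniteAdeleRing (𝓞 F) F)ˣ) : FiniteAdeleRing (𝓞 F) F) =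
      FiniteAdeleRing.baseChange (𝓞 ℚ) ℚ F (𝓞 F) (q : finAdeleQ)) :
    ∃ ε : (FiniteAdeleRing.integralAdeles (𝓞 ℚ) ℚ)ˣ,
      ((ε : FiniteAdeleRing.integralAdeles (𝓞 ℚ) ℚ) : finAdeleQ) = (n : finAdeleQ) * (q : finAdeleQ) := by
  classical
  have h𝔞 : 𝔞 ≠ ⊥ := Literature.NumberTheory.NumberFields.ne_bot_of_span_eq_mul_complexConj_smul hn ha
  have hnQ : (n : ℚ) ≠ 0 := Nat.cast_ne_zero.2 hn
  -- the rational idèle `n · q`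
  let nU : finAdeleQˣ := Units.map (algebraMap ℚ finAdeleQ).toMonoidHom (Units.mk0 (n : ℚ) hnQ)
  have hnU : (nU : finAdeleQ) = (n : finAdeleQ) := by
    change algebraMap ℚ finAdeleQ ((Units.mk0 (n : ℚ) hnQ : ℚˣ) : ℚ) = _
    rw [Units.val_mk0, map_natCast]
  suffices hval : ∀ p : HeightOneSpectrum (𝓞 ℚ), Valued.v (((nU * q : finAdeleQˣ) : finAdeleQ) p) = 1 by
    obtain ⟨ε, hε⟩ := exists_units_integralAdeles_coe_eq' (nU * q) hval
    exact ⟨ε, by rw [hε, Units.val_mul, hnU]⟩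
  intro p
  obtain ⟨v, hv⟩ := exists_under_eq_rat (F := F) p
  -- the conorm of `n q` is `n · z · z̄`
  have hcon : ((Literature.NumberTheory.AdelicBaseChange.finiteIdeleConorm ℚ F (nU * q) : (FiniteAdeleRing (𝓞 F) F)ˣ) : FiniteAdeleRing (𝓞 F) F) =
      (n : FiniteAdeleRing (𝓞 F) F) * (((z : (FiniteAdeleRing (𝓞 F) F)ˣ) : FiniteAdeleRing (𝓞 F) F) *
        conjFiniteAdele (↥(maximalRealSubfield F)) F (IsCMField.complexConj F) ((z : (FiniteAdeleRing (𝓞 F) F)ˣ) : FiniteAdeleRing (𝓞 F) F)) := by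
    rw [Literature.NumberTheory.AdelicBaseChange.coe_finiteIdeleConorm, Literature.NumberTheory.AdelicBaseChange.finiteAdeleRing_mapSemialgHom_apply_eq_baseChange,
      Units.val_mul, hnU,
      map_mul, map_natCast, ← hq]
  -- its valuation at `v` is `1`
  have hmul : ∀ (x y : FiniteAdeleRing (𝓞 F) F) (u : HeightOneSpectrum (𝓞 F)), (x * y) u = x u * y u := fun _ _ _ => rfl
  have hcnt𝔞 : ∀ u : HeightOneSpectrum (𝓞 F), FractionalIdeal.count F u (𝔞 : FractionalIdeal (𝓞 F)⁰ F) =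
      ((Associates.mk u.asIdeal).count (Associates.mk 𝔞).factors : ℤ) := fun u =>
    FractionalIdeal.count_coe F u (show 𝔞 ≠ 0 from h𝔞)
  have hzv : Valued.v (((z : (FiniteAdeleRing (𝓞 F) F)ˣ) : FiniteAdeleRing (𝓞 F) F) v) = WithZero.exp (((Associates.mk v.asIdeal).count (Associates.mk 𝔞).factors : ℤ)) := by
    rw [valued_apply_eq_exp_count_of_toFractionalIdeal_eq_inv _ 𝔞 hz, hcnt𝔞]
  have hzbar : Valued.v ((conjFiniteAdele (↥(maximalRealSubfield F)) F (IsCMField.complexConj F) ((z : (FiniteAdeleRing (𝓞 F) F)ˣ) : FiniteAdeleRing (𝓞 F) F)) v) =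
      WithZero.exp (((Associates.mk ((IsCMField.complexConj F) • v).asIdeal).count (Associates.mk 𝔞).factors : ℤ)) := by
    rw [conjFiniteAdele_apply_apply, valued_galAdicCompletionMap, valued_apply_eq_exp_count_of_toFractionalIdeal_eq_inv _ 𝔞 hz, hcnt𝔞,
      Literature.NumberTheory.NumberFields.complexConj_inv_smul]
  have hnv : Valued.v ((n : FiniteAdeleRing (𝓞 F) F) v) = WithZero.exp (-((Associates.mk v.asIdeal).count (Associates.mk (Ideal.span {((n : ℕ) : 𝓞 F)})).factors : ℤ)) := by
    rw [show (n : FiniteAdeleRing (𝓞 F) F) = algebraMap F (FiniteAdeleRing (𝓞 F) F) ((n : ℕ) : F) from (map_natCast _ n).symm,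
      show (algebraMap F (FiniteAdeleRing (𝓞 F) F) ((n : ℕ) : F)) v = (((n : ℕ) : F) : v.adicCompletion F) from rfl,
      HeightOneSpectrum.valuedAdicCompletion_eq_valuation', valuation_natCast_eq_exp_neg_modulusExp hn v]
    rfl
  have hsum := Literature.NumberTheory.NumberFields.count_add_count_complexConj_smul_eq hn ha v
  have hval1 : Valued.v (((Literature.NumberTheory.AdelicBaseChange.finiteIdeleConorm ℚ F (nU * q) : (FiniteAdeleRing (𝓞 F) F)ˣ) : FiniteAdeleRing (𝓞 F) F) v) = 1 := by
    rw [hcon, hmul, hmul, map_mul, map_mul, hnv, hzv, hzbar, ← WithZero.exp_add, ← WithZero.exp_add, ← WithZero.exp_zero]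
    congr 1
    have hsumZ : (((Associates.mk v.asIdeal).count (Associates.mk 𝔞).factors : ℕ) : ℤ) +
        (((Associates.mk ((IsCMField.complexConj F) • v).asIdeal).count (Associates.mk 𝔞).factors : ℕ) : ℤ) =
        (((Associates.mk v.asIdeal).count (Associates.mk (Ideal.span {((n : ℕ) : 𝓞 F)})).factors : ℕ) : ℤ) := by
      exact_mod_cast hsum
    omega
  -- descend along the conorm: `e_v · ord_p(n q) = 0`
  have hord := Literature.NumberTheory.AdelicBaseChange.unitOrd_finiteIdeleConorm (K := ℚ) (L := F) (nU * q) v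
  rw [hv, (Literature.NumberTheory.Automorphic.FiniteAdeleRing.unitOrd_eq_zero_iff _ v).2 hval1] at hord
  have he : (v.asIdeal.ramificationIdx (𝓞 ℚ) : ℤ) ≠ 0 :=
    Int.natCast_ne_zero.2 (IsDedekindDomain.HeightOneSpectrum.ramificationIdx_ne_zero (𝓞 ℚ) (𝓞 F) (FaithfulSMul.algebraMap_injective _ _) v)
  have hord0 : Literature.NumberTheory.Automorphic.FiniteAdeleRing.unitOrd (𝓞 ℚ) ℚ (nU * q) p = 0 := by
    rcases mul_eq_zero.1 hord.symm with h | h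
    · exact absurd h he
    · exact h
  exact (Literature.NumberTheory.Automorphic.FiniteAdeleRing.unitOrd_eq_zero_iff _ p).1 hord0


/-! ### §7 (ED. 4) The `hint` feeder: `𝓞_F` acts integrally on the frame lattice `Λ_{ũ_β(p)}` -/

omit [IsCMField F] in
/-- The principal adèle of a global integer is an integral adèle. [cite: CasselsFrohlichANT1967, Ch. II §14] -/
private theorem algebraMap_coe_mem_integralFiniteAdeles (x : 𝓞 F) :
    algebraMap F (FiniteAdeleRing (𝓞 F) F) ((x : 𝓞 F) : F) ∈ integralFiniteAdeles F := by
  rw [mem_integralFiniteAdeles_iff]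
  intro u
  rw [HeightOneSpectrum.mem_adicCompletionIntegers, show (algebraMap F (FiniteAdeleRing (𝓞 F) F) ((x : 𝓞 F) : F)) u = (((x : 𝓞 F) : F) : u.adicCompletion F) from rfl,
    HeightOneSpectrum.valuedAdicCompletion_eq_valuation', show ((x : 𝓞 F) : F) = algebraMap (𝓞 F) F x from rfl,
    HeightOneSpectrum.valuation_of_algebraMap]
  exact HeightOneSpectrum.intValuation_le_one u x

/-- **`hint` FEEDER: `ρ(x)·Λ_{ũ_β(p)} ⊆ Λ_{ũ_β(p)}` for every `x ∈ 𝓞_F`** — the frame lattice of any adelic point `p` of `U × T₀` is `𝓞_F`-stable under the integral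
reading (`(ρ x)_𝔸 = P_𝔸·res((1 ⊗ x)•1)·Q_𝔸` commutes with `ũ_β(p)` and has `ẑ`-entries); the hypothesis `hint` of ★ `SiegelAdelicMarking.exists_marking_of_idealKernel`
at `r′ := ũ_β(p)`, `M := (ρ ·)_ℚ` (any `𝔞 ⊆ 𝓞_F`). [cite: Shimura1998, §18.3 pp. 122–123] [cite: Milne2005ShimuraVarieties, §4 pp. 48–49] -/
theorem reading_mulVec_mem_latticeOfGL_auxToGspFinV (Fr : SymplecticFrameV F (RingHom.id F) Jstar ξ g δ)
    (ρ : 𝓞 F →+* Matrix (Fin g ⊕ Fin g) (Fin g ⊕ Fin g) ℤ)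
    (hρ : ∀ b : 𝓞 F, (ρ b).map (Int.cast : ℤ → ℚ) =
      framePV Fr * resMatrix (m := Fin 2) (ratBasis F) (((b : 𝓞 F) : F) • (1 : Matrix (Fin 2) (Fin 2) F)) * frameQV Fr)
    (p : ↥(finAdelic (↥(maximalRealSubfield F)) F (IsCMField.complexConj F) 2 Jstar) × ↥(torusFinAdelic F)) (x : 𝓞 F)
    {v : Fin g ⊕ Fin g → ℚ} (hv : v ∈ latticeOfGL ((auxToGspFinV Fr p : ↥(gspFinAdelic δ)) : GL (Fin g ⊕ Fin g) finAdeleQ)) :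
    ((ρ x).map (Int.cast : ℤ → ℚ)) *ᵥ v ∈ latticeOfGL ((auxToGspFinV Fr p : ↥(gspFinAdelic δ)) : GL (Fin g ⊕ Fin g) finAdeleQ) := by
  classical
  have hmap : ((ρ x).map (Int.cast : ℤ → ℚ)).map (algebraMap ℚ finAdeleQ) = (ρ x).map (Int.cast : ℤ → finAdeleQ) := by
    rw [Matrix.map_map]
    congr 1
    funext n
    simp only [Function.comp_apply, map_intCast]
  have hread : (ρ x).map (Int.cast : ℤ → finAdeleQ) =
      framePVR finAdeleQ Fr * resMatrix (m := Fin 2) (Algebra.TensorProduct.basis finAdeleQ (ratBasis F))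
        (((ratFiniteAdeleTensorEquiv F).symm (algebraMap F (FiniteAdeleRing (𝓞 F) F) ((x : 𝓞 F) : F))) •
          (1 : Matrix (Fin 2) (Fin 2) (finAdeleQ ⊗[ℚ] F))) * frameQVR finAdeleQ Fr := by
    rw [ratFiniteAdeleTensorEquiv_symm_algebraMap, frameScalar_one_tmul_eq_map_reading Fr ρ hρ]
  set U : GL (Fin g ⊕ Fin g) finAdeleQ := ((auxToGspFinV Fr p : ↥(gspFinAdelic δ)) : GL (Fin g ⊕ Fin g) finAdeleQ) with hU
  -- `U⁻¹` commutes with the reading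
  have hcomm : ((U⁻¹ : GL (Fin g ⊕ Fin g) finAdeleQ) : Matrix (Fin g ⊕ Fin g) (Fin g ⊕ Fin g) finAdeleQ) * (ρ x).map (Int.cast : ℤ → finAdeleQ) =
      (ρ x).map (Int.cast : ℤ → finAdeleQ) * ((U⁻¹ : GL (Fin g ⊕ Fin g) finAdeleQ) : Matrix (Fin g ⊕ Fin g) (Fin g ⊕ Fin g) finAdeleQ) := by
    have h := coe_auxToGspFinV_mul_frameScalar Fr p ((1 : finAdeleQ) ⊗ₜ[ℚ] ((x : 𝓞 F) : F))
    rw [frameScalar_one_tmul_eq_map_reading Fr ρ hρ, ← hU] at h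
    calc ((U⁻¹ : GL (Fin g ⊕ Fin g) finAdeleQ) : Matrix (Fin g ⊕ Fin g) (Fin g ⊕ Fin g) finAdeleQ) * (ρ x).map (Int.cast : ℤ → finAdeleQ)
        = ((U⁻¹ : GL (Fin g ⊕ Fin g) finAdeleQ) : Matrix (Fin g ⊕ Fin g) (Fin g ⊕ Fin g) finAdeleQ) *
            ((ρ x).map (Int.cast : ℤ → finAdeleQ) * (U : Matrix (Fin g ⊕ Fin g) (Fin g ⊕ Fin g) finAdeleQ)) *
            ((U⁻¹ : GL (Fin g ⊕ Fin g) finAdeleQ) : Matrix (Fin g ⊕ Fin g) (Fin g ⊕ Fin g) finAdeleQ) := by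
          rw [Matrix.mul_assoc, Matrix.mul_assoc, ← Units.val_mul, mul_inv_cancel, Units.val_one, Matrix.mul_one]
      _ = _ := by rw [← h, ← Matrix.mul_assoc, ← Units.val_mul, inv_mul_cancel, Units.val_one, Matrix.one_mul]
  have hvec : (⇑(algebraMap ℚ finAdeleQ) ∘ (((ρ x).map (Int.cast : ℤ → ℚ)) *ᵥ v)) = (ρ x).map (Int.cast : ℤ → finAdeleQ) *ᵥ (⇑(algebraMap ℚ finAdeleQ) ∘ v) := by
    funext i
    rw [← hmap]
    exact RingHom.map_mulVec (algebraMap ℚ finAdeleQ) _ v i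
  rw [mem_latticeOfGL_iff] at hv ⊢
  rw [hvec, Matrix.mulVec_mulVec, hcomm, ← Matrix.mulVec_mulVec, hread]
  intro i
  rw [Matrix.mulVec, dotProduct]
  exact sum_mem fun k _ => mul_mem
    (frameScalar_integral_of_mem_integralFiniteAdeles Fr ρ hρ (algebraMap_coe_mem_integralFiniteAdeles x) i k) (hv k)


/-! ### §8 (ED. 5) Consumer adapters at `r := r′·ũ_β(1,z)`: the `r′⁻¹ r` ∕ `r⁻¹ r′` tokens of ★ p849931 ∕ ★ p849861 -/

/-- `r′⁻¹ · (r′ · ũ_β(1,z)) = ũ_β(1,z)` in `GSp_δ(𝔸_f)`. [folklore] [cite: Milne2005ShimuraVarieties, §6 p. 75] -/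
theorem inv_mul_mul_auxToGspFinV_one (Fr : SymplecticFrameV F (RingHom.id F) Jstar ξ g δ) (r' : ↥(gspFinAdelic δ)) (z : ↥(torusFinAdelic F)) :
    r'⁻¹ * (r' * auxToGspFinV Fr (1, z)) = auxToGspFinV Fr (1, z) :=
  inv_mul_cancel_left r' _

/-- `(r′ · ũ_β(1,z))⁻¹ · r′ = ũ_β(1, z⁻¹)` in `GSp_δ(𝔸_f)`. [folklore] [cite: Milne2005ShimuraVarieties, §6 p. 75] -/
theorem mul_auxToGspFinV_one_inv_mul (Fr : SymplecticFrameV F (RingHom.id F) Jstar ξ g δ) (r' : ↥(gspFinAdelic δ)) (z : ↥(torusFinAdelic F)) :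
    (r' * auxToGspFinV Fr (1, z))⁻¹ * r' = auxToGspFinV Fr (1, z⁻¹) := by
  rw [_root_.mul_inv_rev, inv_mul_cancel_right, ← map_inv, Prod.inv_mk, inv_one]

/-- **(H1) of ★ `pairingReading_comp_of_similitude` AT THE TORUS LEG**, in its own tokens: for `r := r′·ũ_β(1,z)`, `n ∈ 𝔞`, `[z] = 𝔞⁻¹`,
`n · (r′⁻¹ r) ∈ M_{2g}(ẑ)` (§5 `auxToGspFinV_one_integral_of_natCast_mem`). [cite: Shimura1998, §18.6 proof p. 127] [cite: Milne2005ShimuraVarieties, §6 Thm. 6.11 p. 74 and p. 75] -/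
theorem natCast_mul_inv_mul_torusLeg_integral (Fr : SymplecticFrameV F (RingHom.id F) Jstar ξ g δ)
    (ρ : 𝓞 F →+* Matrix (Fin g ⊕ Fin g) (Fin g ⊕ Fin g) ℤ)
    (hρ : ∀ b : 𝓞 F, (ρ b).map (Int.cast : ℤ → ℚ) =
      framePV Fr * resMatrix (m := Fin 2) (ratBasis F) (((b : 𝓞 F) : F) • (1 : Matrix (Fin 2) (Fin 2) F)) * frameQV Fr)
    (r' : ↥(gspFinAdelic δ)) (z : ↥(torusFinAdelic F)) (𝔞 : Ideal (𝓞 F)) (h𝔞 : 𝔞 ≠ ⊥)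
    (hz : toFractionalIdeal (𝓞 F) F (z : (FiniteAdeleRing (𝓞 F) F)ˣ) = ((𝔞 : FractionalIdeal (𝓞 F)⁰ F))⁻¹) {n : ℕ} (hn : ((n : ℕ) : 𝓞 F) ∈ 𝔞) :
    ∀ i k, (n : finAdeleQ) *
        (((r'⁻¹ * (r' * auxToGspFinV Fr (1, z)) : ↥(gspFinAdelic δ)) : GL (Fin g ⊕ Fin g) finAdeleQ) : Matrix (Fin g ⊕ Fin g) (Fin g ⊕ Fin g) finAdeleQ) i k ∈
      FiniteAdeleRing.integralAdeles (𝓞 ℚ) ℚ := by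
  rw [inv_mul_mul_auxToGspFinV_one]
  exact auxToGspFinV_one_integral_of_natCast_mem Fr ρ hρ z 𝔞 h𝔞 hz hn

/-- **(hμ) of ★ `pairingReading_comp_of_similitude` AT THE TORUS LEG**: the multiplier of `r′⁻¹ r = ũ_β(1,z)` is the rational idèle `q` with `z z̄ = q`
(★ p850156 `isMultiplier_auxToGspFinV` at `a = 1`). [cite: Milne2005ShimuraVarieties, §6 p. 67 (ν(g))] -/
theorem isMultiplier_inv_mul_torusLeg (Fr : SymplecticFrameV F (RingHom.id F) Jstar ξ g δ) (r' : ↥(gspFinAdelic δ)) (z : ↥(torusFinAdelic F))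
    (q : finAdeleQˣ)
    (hq : ((z : (FiniteAdeleRing (𝓞 F) F)ˣ) : FiniteAdeleRing (𝓞 F) F) *
        conjFiniteAdele (↥(maximalRealSubfield F)) F (IsCMField.complexConj F) ((z : (FiniteAdeleRing (𝓞 F) F)ˣ) : FiniteAdeleRing (𝓞 F) F) =
      FiniteAdeleRing.baseChange (𝓞 ℚ) ℚ F (𝓞 F) (q : finAdeleQ)) :
    IsMultiplier (typeFormOver δ finAdeleQ) (((r'⁻¹ * (r' * auxToGspFinV Fr (1, z)) : ↥(gspFinAdelic δ)) : GL (Fin g ⊕ Fin g) finAdeleQ)) q := by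
  rw [inv_mul_mul_auxToGspFinV_one]
  exact isMultiplier_auxToGspFinV Fr 1 z q hq

/-- **`hk` of ★ `levelReading_comp_of_congr` AT THE TORUS LEG**, in its own tokens: for `r := r′·ũ_β(1,z)`, `(r⁻¹ r′) − 1 = ũ_β(1,z⁻¹) − 1 ∈ N·M_{2g}(ẑ)`
from the junction rows (§5 `auxToGspFinV_one_inv_sub_one_of_congr`). [cite: Shimura1998, §18.6 proof p. 127] [cite: Milne2005ShimuraVarieties, §6 Thm. 6.11 p. 74 and §12 (63) p. 116] -/
theorem mul_torusLeg_inv_mul_sub_one_of_congr (Fr : SymplecticFrameV F (RingHom.id F) Jstar ξ g δ)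
    (ρ : 𝓞 F →+* Matrix (Fin g ⊕ Fin g) (Fin g ⊕ Fin g) ℤ)
    (hρ : ∀ b : 𝓞 F, (ρ b).map (Int.cast : ℤ → ℚ) =
      framePV Fr * resMatrix (m := Fin 2) (ratBasis F) (((b : 𝓞 F) : F) • (1 : Matrix (Fin 2) (Fin 2) F)) * frameQV Fr)
    (r' : ↥(gspFinAdelic δ)) (z : ↥(torusFinAdelic F)) (𝔞 : Ideal (𝓞 F))
    (hz : toFractionalIdeal (𝓞 F) F (z : (FiniteAdeleRing (𝓞 F) F)ˣ) = ((𝔞 : FractionalIdeal (𝓞 F)⁰ F))⁻¹) {N : ℕ} (hN : N ≠ 0)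
    (hcong : ∀ v : HeightOneSpectrum (𝓞 F), Ideal.span {((N : ℕ) : 𝓞 F)} ≤ v.asIdeal →
      Valued.v (((z : (FiniteAdeleRing (𝓞 F) F)ˣ) : FiniteAdeleRing (𝓞 F) F) v) = 1 ∧
        Valued.v (((z : (FiniteAdeleRing (𝓞 F) F)ˣ) : FiniteAdeleRing (𝓞 F) F) v - 1) ≤ WithZero.exp (-(modulusExp (Ideal.span {((N : ℕ) : 𝓞 F)}) v : ℤ))) :
    ∀ i j, ∃ t ∈ FiniteAdeleRing.integralAdeles (𝓞 ℚ) ℚ,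
      (((((r' * auxToGspFinV Fr (1, z))⁻¹ * r' : ↥(gspFinAdelic δ)) : GL (Fin g ⊕ Fin g) finAdeleQ) : Matrix (Fin g ⊕ Fin g) (Fin g ⊕ Fin g) finAdeleQ) - 1) i j =
        (N : finAdeleQ) * t := by
  rw [mul_auxToGspFinV_one_inv_mul]
  exact auxToGspFinV_one_inv_sub_one_of_congr Fr ρ hρ z 𝔞 hz hN hcong


/-! ### §9 (ED. 6) (K) and `hint` at a representative moved by a rational matrix: `r′ = γ·ũ_β(p)`, reading `γ ρ(x) γ⁻¹` -/

omit [IsCMField F] in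
/-- `γ⁻¹·((γ M γ⁻¹)·v) = M·(γ⁻¹ v)` for `γ ∈ GL_{2g}(ℚ)`. [folklore] [cite: Milne2005ShimuraVarieties, §4 pp. 48–49] -/
private theorem inv_mulVec_conj_mulVec (γ : GL (Fin g ⊕ Fin g) ℚ) (M : Matrix (Fin g ⊕ Fin g) (Fin g ⊕ Fin g) ℚ) (v : Fin g ⊕ Fin g → ℚ) :
    ((γ⁻¹ : GL (Fin g ⊕ Fin g) ℚ) : Matrix (Fin g ⊕ Fin g) (Fin g ⊕ Fin g) ℚ) *ᵥ
        (((γ : Matrix (Fin g ⊕ Fin g) (Fin g ⊕ Fin g) ℚ) * M * ((γ⁻¹ : GL (Fin g ⊕ Fin g) ℚ) : Matrix (Fin g ⊕ Fin g) (Fin g ⊕ Fin g) ℚ)) *ᵥ v) =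
      M *ᵥ (((γ⁻¹ : GL (Fin g ⊕ Fin g) ℚ) : Matrix (Fin g ⊕ Fin g) (Fin g ⊕ Fin g) ℚ) *ᵥ v) := by
  rw [Matrix.mulVec_mulVec, Matrix.mulVec_mulVec, ← Matrix.mul_assoc, ← Matrix.mul_assoc, ← Units.val_mul, inv_mul_cancel, Units.val_one,
    Matrix.one_mul]

/-- **(K) AT A MOVED REPRESENTATIVE `r′ = γ·ũ_β(p)`** (`γ ∈ GL_{2g}(ℚ)`; the chart՚s `rep (piece a)` with `γ = (q a)⁻¹`, reading `Mρ a = (q a)⁻¹ρ₀(q a) = γρ₀γ⁻¹`):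
`v ∈ Λ_{r′·ũ_β(1,z)} ↔ ∀ x ∈ 𝔞, (γρ(x)γ⁻¹)·v ∈ Λ_{r′}` — §4 transported by `Λ_{γ s} = γ·Λ_s` (★ `mem_latticeOfGL_map_mul_iff`); ★ p849685՚s `hr` at
`(r′, r′·ũ_β(1,z), M := γρ(·)_ℚγ⁻¹)`. [cite: Shimura1998, §18.3 pp. 122–123, §18.6 pp. 124–127] [cite: Milne2005ShimuraVarieties, §4 pp. 48–49, §6 Thm. 6.11 p. 74 and p. 75] -/
theorem mem_latticeOfGL_mul_torusLeg_iff_of_coe_eq_map_mul (Fr : SymplecticFrameV F (RingHom.id F) Jstar ξ g δ)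
    (ρ : 𝓞 F →+* Matrix (Fin g ⊕ Fin g) (Fin g ⊕ Fin g) ℤ)
    (hρ : ∀ b : 𝓞 F, (ρ b).map (Int.cast : ℤ → ℚ) =
      framePV Fr * resMatrix (m := Fin 2) (ratBasis F) (((b : 𝓞 F) : F) • (1 : Matrix (Fin 2) (Fin 2) F)) * frameQV Fr)
    (p : ↥(finAdelic (↥(maximalRealSubfield F)) F (IsCMField.complexConj F) 2 Jstar) × ↥(torusFinAdelic F))
    (z : ↥(torusFinAdelic F)) (𝔞 : Ideal (𝓞 F)) (h𝔞 : 𝔞 ≠ ⊥)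
    (hz : toFractionalIdeal (𝓞 F) F (z : (FiniteAdeleRing (𝓞 F) F)ˣ) = ((𝔞 : FractionalIdeal (𝓞 F)⁰ F))⁻¹)
    (γ : GL (Fin g ⊕ Fin g) ℚ) (r' : ↥(gspFinAdelic δ))
    (hr' : ((r' : ↥(gspFinAdelic δ)) : GL (Fin g ⊕ Fin g) finAdeleQ) =
      Matrix.GeneralLinearGroup.map (algebraMap ℚ finAdeleQ) γ * ((auxToGspFinV Fr p : ↥(gspFinAdelic δ)) : GL (Fin g ⊕ Fin g) finAdeleQ))
    (v : Fin g ⊕ Fin g → ℚ) :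
    v ∈ latticeOfGL (((r' * auxToGspFinV Fr (1, z) : ↥(gspFinAdelic δ)) : GL (Fin g ⊕ Fin g) finAdeleQ)) ↔
      ∀ x ∈ 𝔞, (((γ : Matrix (Fin g ⊕ Fin g) (Fin g ⊕ Fin g) ℚ) * (ρ x).map (Int.cast : ℤ → ℚ) *
          ((γ⁻¹ : GL (Fin g ⊕ Fin g) ℚ) : Matrix (Fin g ⊕ Fin g) (Fin g ⊕ Fin g) ℚ))) *ᵥ v ∈
        latticeOfGL ((r' : ↥(gspFinAdelic δ)) : GL (Fin g ⊕ Fin g) finAdeleQ) := by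
  rw [Subgroup.coe_mul, hr', mul_assoc, ← Subgroup.coe_mul, Literature.NumberTheory.Adeles.mem_latticeOfGL_map_mul_iff,
    mem_latticeOfGL_auxToGspFinV_mul_torusLeg_iff Fr ρ hρ p z 𝔞 h𝔞 hz]
  refine forall₂_congr fun x _ => ?_
  rw [Literature.NumberTheory.Adeles.mem_latticeOfGL_map_mul_iff, inv_mulVec_conj_mulVec]

/-- **`hint` AT A MOVED REPRESENTATIVE `r′ = γ·ũ_β(p)`**: `(γρ(x)γ⁻¹)·Λ_{r′} ⊆ Λ_{r′}` for every `x ∈ 𝓞_F` (§7 transported). ★ p849685՚s `hint` at `(r′, M := γρ(·)_ℚγ⁻¹)`.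
[cite: Shimura1998, §18.3 pp. 122–123] [cite: Milne2005ShimuraVarieties, §4 pp. 48–49] -/
theorem conj_reading_mulVec_mem_latticeOfGL_of_coe_eq_map_mul (Fr : SymplecticFrameV F (RingHom.id F) Jstar ξ g δ)
    (ρ : 𝓞 F →+* Matrix (Fin g ⊕ Fin g) (Fin g ⊕ Fin g) ℤ)
    (hρ : ∀ b : 𝓞 F, (ρ b).map (Int.cast : ℤ → ℚ) =
      framePV Fr * resMatrix (m := Fin 2) (ratBasis F) (((b : 𝓞 F) : F) • (1 : Matrix (Fin 2) (Fin 2) F)) * frameQV Fr)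
    (p : ↥(finAdelic (↥(maximalRealSubfield F)) F (IsCMField.complexConj F) 2 Jstar) × ↥(torusFinAdelic F))
    (γ : GL (Fin g ⊕ Fin g) ℚ) (r' : ↥(gspFinAdelic δ))
    (hr' : ((r' : ↥(gspFinAdelic δ)) : GL (Fin g ⊕ Fin g) finAdeleQ) =
      Matrix.GeneralLinearGroup.map (algebraMap ℚ finAdeleQ) γ * ((auxToGspFinV Fr p : ↥(gspFinAdelic δ)) : GL (Fin g ⊕ Fin g) finAdeleQ))
    (x : 𝓞 F) {v : Fin g ⊕ Fin g → ℚ} (hv : v ∈ latticeOfGL ((r' : ↥(gspFinAdelic δ)) : GL (Fin g ⊕ Fin g) finAdeleQ)) :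
    (((γ : Matrix (Fin g ⊕ Fin g) (Fin g ⊕ Fin g) ℚ) * (ρ x).map (Int.cast : ℤ → ℚ) *
        ((γ⁻¹ : GL (Fin g ⊕ Fin g) ℚ) : Matrix (Fin g ⊕ Fin g) (Fin g ⊕ Fin g) ℚ))) *ᵥ v ∈
      latticeOfGL ((r' : ↥(gspFinAdelic δ)) : GL (Fin g ⊕ Fin g) finAdeleQ) := by
  rw [hr', Literature.NumberTheory.Adeles.mem_latticeOfGL_map_mul_iff] at hv ⊢
  rw [inv_mulVec_conj_mulVec]
  exact reading_mulVec_mem_latticeOfGL_auxToGspFinV Fr ρ hρ p x hv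

end AuxV

end UnitaryCurve

end Literature.AlgebraicGeometry.ShimuraVarieties

end
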